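import Summits.AtomisticToContinuum.BoseEinsteinCondensation.Theses.BECGroundStateSOS
import Literature.MathematicalPhysics.QuantumLattice.XYOrderGDProofs
import Literature.MathematicalPhysics.QuantumLattice.LiebMattisMatrixElements
import Literature.MathematicalPhysics.QuantumLattice.LatticeToriLROProofs
import Literature.Probability.LatticeModels.GaussianDomination
import Literature.MathematicalPhysics.QuantumLattice.Z2GaugeHiggsTorus
import Literature.MathematicalPhysics.QuantumLattice.XYZGroundStateOrderCorrIneq

/-!
# Disproof of `LatticeODLROOffHalfFilling` — findings (crux stmt-AtomisticToContinuum-11033)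

Standing-adversary work file (cdisprove seat `refuter-cdisprove-stmt-AtomisticToContinuum-11033`,
cycles 1–2, 2026-08-16). Everything below is `lean check`ed, sorry-free, axioms
`{propext, Classical.choice, Quot.sound}` unless a docstring says NEAR-MISS.

The crux (route BECGroundStateSOS, rank 2): `∃ μ₀ > 0, ∀ |μ| < μ₀, LROAt μ`, where `LROAt μ`
(this file, VERBATIM the crux matrix) is off-diagonal long-range order
`0 < liminf_k |Λ_k|⁻² Σ_{x,y} Re Σ_{α=1,2} ω_{L,μ}(S^α_x S^α_y)` of the TRACIAL ground states of
`H_{L,μ} = xxzHamiltonian 1 (torusGraph 3 L) (-1) 0 − μ • totalSpin 1 2`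
`= −Σ_{⟨xy⟩}(S¹_xS¹_y + S²_xS²_y) − μ S³_tot` (spin ½ = hard-core bosons at chemical potential `μ`)
on the even tori `(ℤ/2kℤ)³`.

## Findings (index)

* READ-BACK / TYPING. Elaborates (rc 0); `latticeODLRO_iff : crux ↔ ∃ μ₀>0, ∀|μ|<μ₀, LROAt μ`
  is `Iff.rfl`. The summand is honest: `Σ_{x,y} S^αS^α = (S^α_tot)² ≥ 0`, so each `liminf` term
  lies in `[0, ½]` (no junk `sSup`); `L = 0` and `k = 0` are guarded / irrelevant at `atTop`.
* CALIBRATION `lroAt_zero` (PROVED): the `μ = 0` slice IS the in-tree Kennedy–Lieb–Shastry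
  theorem `kennedy_lieb_shastry_xy_ground_holds 3 _ 1 _` after `zero_smul, sub_zero`
  (`Fin.castSucc ≡ Fin.castLE` definitionally). So signs (`J = −1` ferromagnetic XY),
  components and normalisation are exactly KLS's: the crux is well-posed and its half-filling
  endpoint is a theorem; the whole content is `μ ≠ 0`.
* (a) LOAD-BEARING HYPOTHESES. The crux has one genuine hypothesis, smallness `|μ| < μ₀`:
  `latticeODLRO_false_without_smallMu : ¬ ∀ μ, LROAt μ` (PROVED, witness `μ = 4`), and
  quantitatively `not_lroAt_of_three_lt : 3 < μ → ¬ LROAt μ`, `mu0_le_three : (∀ |μ|<μ₀, LROAt μ)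
  → μ₀ ≤ 3`. Mechanism: above the saturation field `|μ| = 2dS = 3` the fully polarised product
  state is the unique ground state; proved here by an SOS CERTIFICATE in exactly the cone the
  route wants to search (`hmu_decomp`):
  `H_{L,μ} + (μ|Λ|/2)·1 − (μ−3)·N↓ = ½ Σ_x Σ_i (S⁺_x − S⁺_{x+eᵢ})ᴴ(S⁺_x − S⁺_{x+eᵢ})`,
  with `N↓ = Σ_x S⁻_xS⁺_x`; evaluated in the ground state against the variational bound
  `E₀ ≤ −μ|Λ|/2` (`groundEnergy_hmu_le`) it forces `ω(P↓_x) = 0` (`re_gsf_Pd_eq_zero`), and the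
  two bond certificates `hop_eq_sub` / `hop_eq_add`
  (`S¹_xS¹_y + S²_xS²_y = ½(P↓_x+P↓_y) − ½|S⁺_x − S⁺_y|² = ½|S⁺_x + S⁺_y|² − ½(P↓_x+P↓_y)`)
  squeeze the two-point function to `½δ_{xy}` (`corr_eq`), whence the `k`-th liminf term is
  exactly `1/(16k³)` (`orderParam_eq`). The structural parameters `d = 3`, even side, `S = ½`
  are not hypotheses of the decl; for the record: `d = 1` would be FALSE (XX chain in a field =
  free fermions by Jordan–Wigner, `⟨S⁺_0S⁻_r⟩ ~ r^{-1/2}`, McCoy 1968; continuum analogue = barrier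
  `Literature.Barriers.AtomisticToContinuum.OneDimensionalHardCore`), `d = 2` ground states are
  expected TRUE (KLS holds at `T = 0`, `d = 2`), odd sides expected TRUE (RP needs even sides, the
  truth does not).
* SYMMETRY `μ ↦ −μ` (PROVED, `lroAt_neg_iff : LROAt (−μ) ↔ LROAt μ`, from `corr_neg_mu`: the
  two-point function of `H_{L,−μ}` equals that of `H_{L,μ}` for `L ≥ 3`, by covariance of the
  tracial ground state under the flip `U = ⨂σˣ`, `U H_{L,μ} Uᴴ = H_{L,−μ}`): provers may assume
  `0 ≤ μ < μ₀` (`forall_abs_lt_iff`), and `not_lroAt_of_lt_neg_three` closes `μ < −3` as well.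
* (b) TIGHTNESS / THE BOUNDARY POINT (PROVED). `μ₀ ≤ 3` is necessary (`mu0_le_three`), and the
  boundary itself carries no order: `not_lroAt_three : ¬ LROAt 3`, `not_lroAt_neg_three`, hence
  `abs_lt_three_of_lroAt : LROAt μ → |μ| < 3` — the ODLRO set is contained in the OPEN interval
  `(−3, 3)` (physically it is expected to BE `(−3, 3)`: superfluid at every filling `0 < n < 1`).
  Mechanism at `μ = 3` (section `Boundary`): the certificate has no `N↓` term, so ground vectors
  are exactly the kernel of all bond squares (`bond_mulVec_eq_zero_of_mem`); walking along bonds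
  (`E_mulVec_eq_of_bonds`, potential `tdist`) gives `S⁺_x v = λ|⇑⟩` for every `x` with ONE
  amplitude `λ = v(x↓)` (`E_mulVec_eq_smul_upVec`, `apply_single_eq`: the ground space is
  `span{|⇑⟩, |q=0 magnon⟩}`), whence `‖S⁺_tot v‖² = |Λ|²|λ|² ≤ |Λ|‖v‖²` and, with the operator
  identity `Σ_{x,y} hop = (S⁺_tot)ᴴS⁺_tot + S³_tot` (`sum_hop_eq`), `Re⟨v, O v⟩ ≤ (3|Λ|/2)‖v‖²` on
  the ground space; positivity transfer to the tracial state (`re_gsf_nonneg_of_groundSpace`, a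
  general lemma: `tr(P₀T) = Σ_σ⟨P₀e_σ, T P₀e_σ⟩`) gives `Re ω(O) ≤ 3|Λ|/2`, i.e. the `k`-th term is
  in `[0, 3/(2(2k)³)]`.
* OFF HALF FILLING IS FORCED (PROVED, section `OffHalf`, `offHalfFilling_forced`): for every
  `μ ≠ 0` there is `L₀` such that on every even torus of side `L ≥ L₀` no nonzero ground vector
  `v` of `H_{L,μ}` has `S³_tot v = 0`. So the shortcut "the KLS ground state persists for small
  `μ` (finite-size gap / perturbation theory)" is FALSE at every fixed `μ ≠ 0`, and a proof of
  the crux must control ground states in sectors `S³_tot ≠ 0`, where site-local reflection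
  positivity of the state is unavailable (`HalfFillingReflectionPositivityNarrow`). Proof
  (Koma–Tasaki): KLS quantitatively (`lroAt_zero` ⇒ eventually `Re ω₀(Σ hop) > c₀|Λ|²`,
  `orderParam_eq_re_gsf`); the columns of `P₀(H_{L,0})` are simultaneous `S³_tot`-eigenvectors
  (`[H_{L,μ}, S³_tot] = 0`, `commute_hmu_totalSpin_two`; `totalSpin_two_mulVec_single`) and one
  of them, `ψ`, inherits the order (`exists_col_quad_ge`, via `tr(P₀T) = Σ_σ⟨P₀e_σ,TP₀e_σ⟩`);
  a half-filled ground vector of `H_{L,μ}` would give `E₀(μ) ≥ E₀(0)`, but at `μ > 0` the trial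
  states `ψ`, `Uψ` (if `S³ψ = Mψ`, `M ≠ 0`) or `w = S⁺_tot ψ` (if `M = 0`: `‖w‖² = Re⟨ψ,Oψ⟩ ≥
  c₀|Λ|²‖ψ‖²`, `S³w = w`, and `Re⟨w,(H₀−E₀)w⟩ ≤ Re⟨ψ,[S⁻_tot,[H₀,S⁺_tot]]ψ⟩ ≤ 6|Λ|‖ψ‖²` by the
  symmetrisation `re_excess_le_doubleComm` and the EXPLICIT double commutator
  `[S⁻_tot,[H_{L,0},S⁺_tot]] = Σ_{x,i}(2 hop − 4 S³S³)(x,x+eᵢ)`, `doubleComm_eq`) have energy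
  `< E₀(0)` once `c₀ μ |Λ| > 6` (`offHalf_core`); `μ < 0` by the flip.
* `groundEnergy_hmu_le_zero` (PROVED): `E₀(H_{L,μ}) ≤ E₀(H_{L,0})` for all `μ` — the input for
  the provers' `μ`-deformed bond-energy bound (D_μ): `ω_μ(H_XY) ≤ E₀(0) + |μ||Λ|/2`.
* (c) NATURAL STRENGTHENINGS REFUTED: "ODLRO at every chemical potential" (above); "the
  half-filled (KLS) ground state is a ground state of `H_{L,μ}` for small `μ`" (above). No finite-`k`
  strengthening is decidable here (ground states of `2^{(2k)³}`-dimensional matrices over `ℂ`).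
* NUMERICS (evidence `gd_numerics_summary.md`, kit j009826; exact diagonalisation of THIS Hamiltonian
  in `d = 1` (rings `L = 8, 10, 12`) and `d = 2` (torus `4×4`), full space, all `μ` up to saturation
  `|μ| = d`): the `μ`-DEFORMED GROUND-STATE GAUSSIAN DOMINATION `E₀(H_μ(th)) ≥ E₀(H_μ)` (fields
  `h = cos, sin(q·x)`, all `q ≠ 0`, `t ∈ {½,1,2}`) and its second-order form, the susceptibility
  bound `χ_h ≤ Q(h)/2` that feeds KLS's (A), are NEVER violated: the worst ratio `χ_h/(Q/2)` rises
  monotonically from `0.42` at `μ = 0` (KLS theorem: `≤ 1`, sanity OK) to `0.95` at saturation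
  (analytic here: `(E_q/2)/((μ−d)+E_q/2) → 1⁻`), argmax at `q = (π,π)` off half filling, while the
  smallest-`q` modes keep `≈ 0.42–0.46` up to quarter filling and the `O(μ)` loss near `μ = 0` is
  invisible (`Δr = 0.001` at `μ = 0.25`). So the route's sub-crux (A_μ) "infrared bound with
  `(1+O(μ))` slack" is CONSISTENT with small-system exact numerics — nothing refutes it; caveat
  16–18 sites. 3D `4³` torus, dilute-hole sectors `n↓ = 1,2,3` (kit j016403, `μ ∈ (2.76, 3)` just
  below the saturation threshold `μ₁ = 3.000` = `E(0) − E(1)`, reproduced exactly): worst ratio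
  `0.98, 0.96, 0.94` (argmax `q = (π,π,π)`), decreasing away from saturation — no violation; the
  `n↓ = 0` analytic ratio `(E_q/2)/((μ−3)+E_q/2)` is reproduced to `10⁻¹⁶` (code validation).
* (d) TARGETS: none yet (no line picked, `stuck_stubs = []`).
* (e) WHY THE CRUX RESISTS (no kill expected): (1) it is the `T = 0`, `d = 3` hard-core lattice
  Bose gas off half filling, whose condensation at every `0 < |μ| < 3` is the consensus of
  spin-wave theory and QMC and an OPEN PROBLEM since KLS 1988 ("no one has so far found a way",
  LSSY2005 Ch. 11 §11.1) — a refutation would need a NEW no-go mechanism for continuous-symmetry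
  breaking in `d = 3` ground states, and none exists (Mermin–Wagner/Pitaevskii–Stringari bite only
  in `d ≤ 2` / `d = 1`); (2) every finite-`k` term is `> 0` and `≤ ½`, so no finite computation
  refutes a `liminf`; (3) the only formal escape hatches — sign conventions, component indexing,
  junk values, quantifier order — are closed by `lroAt_zero` (the `μ = 0` slice is literally KLS).
  What the disproof side CAN say to provers: any proof must (i) use `|μ| < μ₀ ≤ 3` (and nothing
  is lost by restricting to `0 ≤ μ < μ₀`, `forall_abs_lt_iff`); (ii) work
  genuinely off half filling — for fixed `μ ≠ 0` the ground sector is NOT `S³_tot = 0` once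
  `|Λ| > C/|μ|` (elementary: the trial states `S^±_tot|GS₀⟩` have energy excess
  `⟨[S∓_tot,[H,S^±_tot]]⟩/2‖S^±_tot GS₀‖² = O(|Λ|)/Ω(|Λ|²) = O(1/|Λ|)` by KLS's own LRO, the
  Koma–Tasaki low-lying states), and linear response predicts magnetisation density `≈ χμ`;
  hence site-local reflection positivity of the state is unavailable
  (`HalfFillingReflectionPositivityNarrow`: RP forces `⟨N⟩ = |Λ|/2`); (iii) the
  certificate format of `hmu_decomp`/`hop_eq_sub` is the `q = 0`, dilute-limit member of the
  family the route seeks — at `μ < 3` the constant term must be replaced by the momentum-resolved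
  infrared bound, which is where K1 (certificate range vs `1/q`) lives.
-/

noncomputable section

namespace Summit.AtomisticToContinuum.BoseEinsteinCondensation.Cruxes.LatticeODLROOffHalfFilling.Disproof

open Literature.MathematicalPhysics.QuantumLattice Literature.Probability.LatticeModels Matrix Finset
open scoped ComplexOrder BigOperators

/-! ### Spin-½ single-site algebra: `S⁺ = |↑⟩⟨↓|`, `P↓ = |↓⟩⟨↓|` -/

section SingleSite

/-- The spin-½ raising matrix `e = |↑⟩⟨↓|` (basis `0 = ↑`, `1 = ↓`). [folklore] -/
def raise : Matrix (Fin 2) (Fin 2) ℂ := !![0, 1; 0, 0]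

/-- The projection `P↓ = |↓⟩⟨↓|` onto the down state. [folklore] -/
def pDown : Matrix (Fin 2) (Fin 2) ℂ := !![0, 0; 0, 1]

/-- `S⁻S⁺ = P↓` for spin ½. [folklore] -/
theorem raise_conjTranspose_mul_raise : raiseᴴ * raise = pDown := by
  ext i j
  fin_cases i <;> fin_cases j <;> simp [raise, pDown, Matrix.mul_apply, conjTranspose_apply]

/-- `σˣ = e + eᴴ`. [folklore] -/
theorem spinHalfPauli_zero_eq : spinHalfPauli 0 = raise + raiseᴴ := by
  ext i j
  fin_cases i <;> fin_cases j <;> simp [raise, spinHalfPauli, conjTranspose_apply]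

/-- `σʸ = i(eᴴ − e)`. [folklore] -/
theorem spinHalfPauli_one_eq : spinHalfPauli 1 = Complex.I • (raiseᴴ - raise) := by
  ext i j
  fin_cases i <;> fin_cases j <;> simp [raise, spinHalfPauli, conjTranspose_apply]

/-- `σᶻ = 1 − 2P↓`. [folklore] -/
theorem spinHalfPauli_two_eq : spinHalfPauli 2 = 1 - (2 : ℂ) • pDown := by
  ext i j
  fin_cases i <;> fin_cases j <;> simp [pDown, spinHalfPauli]
  norm_num

/-- `(S^α)² = ¼` for spin ½. [folklore] -/
theorem spinVec_one_mul_self (α : Fin 3) :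
    spinVec 1 α * spinVec 1 α = (1 / 4 : ℂ) • (1 : Matrix (Fin 2) (Fin 2) ℂ) := by
  rw [spinVec_one_eq_half_spinHalfPauli, smul_mul_smul_comm, Z2GaugeHiggs.spinHalfPauli_mul_self]
  norm_num

end SingleSite

/-! ### Site operators on a finite lattice -/

section Sites

variable {Λ : Type*} [Fintype Λ] [DecidableEq Λ]

/-- `S⁺_x`. [folklore] -/
def E (x : Λ) : Op Λ 2 := onSite x raise

/-- `P↓_x = S⁻_x S⁺_x` (number of down spins at `x`). [folklore] -/
def Pd (x : Λ) : Op Λ 2 := onSite x pDown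

/-- The XY bond (hopping) operator `S¹_x S¹_y + S²_x S²_y`, exactly the summand of the crux's
order parameter. [folklore] -/
def hop (x y : Λ) : Op Λ 2 := siteSpin 1 x 0 * siteSpin 1 y 0 + siteSpin 1 x 1 * siteSpin 1 y 1

/-- `(S⁺_x)ᴴ = S⁻_x`. [folklore] -/
theorem E_conjTranspose (x : Λ) : (E x)ᴴ = onSite x raiseᴴ := by
  rw [E, onSite_conjTranspose]

/-- `S¹_x = ½(S⁺_x + S⁻_x)`. [folklore] -/
theorem siteSpin_zero_eq (x : Λ) : siteSpin 1 x 0 = (1 / 2 : ℂ) • (E x + (E x)ᴴ) := by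
  rw [siteSpin, spinVec_one_eq_half_spinHalfPauli, spinHalfPauli_zero_eq, onSite_smul',
    onSite_add', E_conjTranspose, E]

/-- `S²_x = (i/2)(S⁻_x − S⁺_x)`. [folklore] -/
theorem siteSpin_one_eq (x : Λ) :
    siteSpin 1 x 1 = ((1 / 2 : ℂ) * Complex.I) • ((E x)ᴴ - E x) := by
  rw [siteSpin, spinVec_one_eq_half_spinHalfPauli, spinHalfPauli_one_eq, onSite_smul',
    onSite_smul', onSite_sub', E_conjTranspose, E, smul_smul]

/-- `S³_x = ½ − P↓_x`. [folklore] -/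
theorem siteSpin_two_eq (x : Λ) : siteSpin 1 x 2 = (1 / 2 : ℂ) • 1 - Pd x := by
  rw [siteSpin, spinVec_one_eq_half_spinHalfPauli, spinHalfPauli_two_eq, onSite_smul',
    onSite_sub', onSite_one', onSite_smul', Pd, smul_sub, smul_smul]
  norm_num

/-- `S⁻_xS⁺_x = P↓_x`. [folklore] -/
theorem E_conjTranspose_mul_E (x : Λ) : (E x)ᴴ * E x = Pd x := by
  rw [E_conjTranspose, E, onSite_mul, raise_conjTranspose_mul_raise, Pd]

/-- `(S^α_x)² = ¼` for spin ½. [folklore] -/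
theorem siteSpin_mul_self (x : Λ) (α : Fin 3) :
    siteSpin 1 x α * siteSpin 1 x α = (1 / 4 : ℂ) • (1 : Op Λ 2) := by
  rw [siteSpin, onSite_mul, spinVec_one_mul_self, onSite_smul', onSite_one']

/-- `S¹_xS¹_y + S²_xS²_y = ½(S⁺_xS⁻_y + S⁻_xS⁺_y)` (any ring). [folklore] -/
theorem hop_eq (x y : Λ) : hop x y = (1 / 2 : ℂ) • (E x * (E y)ᴴ + (E x)ᴴ * E y) := by
  rw [hop, siteSpin_zero_eq, siteSpin_zero_eq, siteSpin_one_eq, siteSpin_one_eq]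
  have hI : (1 / 2 : ℂ) * Complex.I * ((1 / 2 : ℂ) * Complex.I) = -(1 / 4 : ℂ) := by
    ring_nf
    rw [Complex.I_sq]
    ring
  rw [smul_mul_smul_comm, smul_mul_smul_comm, hI]
  simp only [add_mul, mul_add, sub_mul, mul_sub, smul_add, smul_sub]
  module

/-- SOS identity 1: `hop = ½(P↓_x + P↓_y) − ½ (S⁺_x − S⁺_y)ᴴ(S⁺_x − S⁺_y)` for `x ≠ y`. [folklore] -/
theorem hop_eq_sub {x y : Λ} (hxy : x ≠ y) :
    hop x y = (1 / 2 : ℂ) • (Pd x + Pd y) - (1 / 2 : ℂ) • ((E x - E y)ᴴ * (E x - E y)) := by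
  have hcomm : E x * (E y)ᴴ = (E y)ᴴ * E x := by
    rw [E_conjTranspose, E, onSite_mul_onSite_comm hxy]
  rw [hop_eq, conjTranspose_sub, sub_mul, mul_sub, mul_sub, E_conjTranspose_mul_E,
    E_conjTranspose_mul_E, hcomm]
  module

/-- SOS identity 2: `hop = ½ (S⁺_x + S⁺_y)ᴴ(S⁺_x + S⁺_y) − ½(P↓_x + P↓_y)` for `x ≠ y`. [folklore] -/
theorem hop_eq_add {x y : Λ} (hxy : x ≠ y) :
    hop x y = (1 / 2 : ℂ) • ((E x + E y)ᴴ * (E x + E y)) - (1 / 2 : ℂ) • (Pd x + Pd y) := by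
  have hcomm : E x * (E y)ᴴ = (E y)ᴴ * E x := by
    rw [E_conjTranspose, E, onSite_mul_onSite_comm hxy]
  rw [hop_eq, conjTranspose_add, add_mul, mul_add, mul_add, E_conjTranspose_mul_E,
    E_conjTranspose_mul_E, hcomm]
  module


/-- `S³_tot = |Λ|/2 − N↓` for spin ½. [folklore] -/
theorem totalSpin_two_eq :
    (totalSpin 1 2 : Op Λ 2) = ((Fintype.card Λ : ℂ) / 2) • 1 - ∑ x : Λ, Pd x := by
  unfold totalSpin
  simp only [siteSpin_two_eq, Finset.sum_sub_distrib, Finset.sum_const, Finset.card_univ]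
  rw [← Nat.cast_smul_eq_nsmul ℂ, smul_smul]
  congr 1
  ring

/-- The all-up (fully polarised) basis vector: the completely filled hard-core lattice gas
(`a†_x = S⁺_x`), equivalently — after the flip `U` — the empty one. [folklore] -/
def upVec : TensorIndex Λ 2 → ℂ := Pi.single (fun _ => (0 : Fin 2)) 1

/-- The all-up vector vanishes on any configuration with a down spin at `x`. [folklore] -/
theorem upVec_update_one (σ : TensorIndex Λ 2) (x : Λ) :
    (upVec : TensorIndex Λ 2 → ℂ) (Function.update σ x 1) = 0 := by
  rw [upVec, Pi.single_apply, if_neg]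
  intro h
  have := congr_fun h x
  simp at this

/-- `S⁺_x |⇑⟩ = 0`. [folklore] -/
theorem E_mulVec_upVec (x : Λ) : E x *ᵥ (upVec : TensorIndex Λ 2 → ℂ) = 0 := by
  ext σ
  rw [E, LiebMattis.onSite_mulVec_apply, Fin.sum_univ_two, Pi.zero_apply, upVec_update_one, mul_zero,
    add_zero]
  have h0 : ∀ k : Fin 2, raise k 0 = 0 := by
    intro k; fin_cases k <;> simp [raise]
  rw [h0, zero_mul]

/-- `P↓_x |⇑⟩ = 0`. [folklore] -/
theorem Pd_mulVec_upVec (x : Λ) : Pd x *ᵥ (upVec : TensorIndex Λ 2 → ℂ) = 0 := by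
  ext σ
  rw [Pd, LiebMattis.onSite_mulVec_apply, Fin.sum_univ_two, Pi.zero_apply, upVec_update_one, mul_zero,
    add_zero]
  have h0 : ∀ k : Fin 2, pDown k 0 = 0 := by
    intro k; fin_cases k <;> simp [pDown]
  rw [h0, zero_mul]

/-- `⟨⇑|⇑⟩ = 1`. [folklore] -/
theorem star_upVec_dotProduct_upVec :
    star (upVec : TensorIndex Λ 2 → ℂ) ⬝ᵥ upVec = 1 := by
  simp [upVec]

end Sites

/-! ### The crux Hamiltonian on the torus `(ℤ/Lℤ)³` above the saturation field `μ > 3` -/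

section Torus

variable (L : ℕ) [NeZero L]

/-- The crux's Hamiltonian `H_{L,μ} = −Σ_{⟨xy⟩}(S¹_xS¹_y + S²_xS²_y) − μ S³_tot` (verbatim the
matrix fed to `groundStateFunctional` in `LatticeODLROOffHalfFilling`). [folklore] -/
abbrev Hmu (μ : ℝ) : Op (TorusSite 3 L) 2 :=
  xxzHamiltonian 1 (torusGraph 3 L) (-1) 0 - (μ : ℂ) • totalSpin 1 2

/-- `H_{L,μ}` is Hermitian (real `μ`). [folklore] -/
theorem Hmu_isHermitian (μ : ℝ) : (Hmu L μ).IsHermitian :=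
  (xxzHamiltonian_isHermitian 1 _ (-1) 0).sub ((totalSpin_isHermitian 1 2).ofReal_smul μ)

/-- Unfolding the edge sum of `xxzHamiltonian` on the torus of side `L ≥ 3` into the sum over the
`3|Λ|` directed bonds `(x, x + eᵢ)` (`sum_edgeFinset_torusGraph`). [folklore] -/
theorem xxz_eq_sum_bonds (hL : 3 ≤ L) :
    xxzHamiltonian 1 (torusGraph 3 L) (-1) 0 =
      ((-1 : ℝ) : ℂ) • ∑ x : TorusSite 3 L, ∑ i : Fin 3,
        (spinBond 1 0 x (x + Pi.single i 1) + spinBond 1 1 x (x + Pi.single i 1) +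
          ((0 : ℝ) : ℂ) • spinBond 1 2 x (x + Pi.single i 1)) := by
  unfold xxzHamiltonian
  rw [sum_edgeFinset_torusGraph hL]
  rfl

/-- On the torus of side `L ≥ 3` the XY Hamiltonian is minus the sum of the hopping operators over
the `3|Λ|` directed bonds `(x, x + eᵢ)`. [folklore] -/
theorem xxz_eq (hL : 3 ≤ L) :
    xxzHamiltonian 1 (torusGraph 3 L) (-1) 0 =
      -∑ x : TorusSite 3 L, ∑ i : Fin 3, hop x (x + Pi.single i 1) := by
  have hL2 : 2 ≤ L := by omega
  rw [xxz_eq_sum_bonds L hL, Complex.ofReal_neg, Complex.ofReal_one, neg_smul, one_smul, neg_inj]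
  refine Finset.sum_congr rfl fun x _ => Finset.sum_congr rfl fun i _ => ?_
  have hne : x ≠ x + Pi.single i 1 := fun h =>
    torus_single_ne_zero hL2 i (left_eq_add.mp h)
  rw [spinBond_eq_mul_of_ne hne, spinBond_eq_mul_of_ne hne, Complex.ofReal_zero, zero_smul,
    add_zero, hop]

/-- **The saturation SOS certificate.** For `L ≥ 3`:
`H_{L,μ} = −(μ|Λ|/2)·1 + (μ − 3)·N↓ + ½ Σ_x Σ_i (S⁺_x − S⁺_{x+eᵢ})ᴴ(S⁺_x − S⁺_{x+eᵢ})`.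
For `μ > 3` every term after the constant is a positive multiple of a square. [folklore] -/
theorem hmu_decomp (hL : 3 ≤ L) (μ : ℝ) :
    Hmu L μ = ((-(μ * Fintype.card (TorusSite 3 L) / 2) : ℝ) : ℂ) • (1 : Op (TorusSite 3 L) 2)
      + ((μ - 3 : ℝ) : ℂ) • (∑ x : TorusSite 3 L, Pd x)
      + ((1 / 2 : ℝ) : ℂ) • ∑ x : TorusSite 3 L, ∑ i : Fin 3,
          (E x - E (x + Pi.single i 1))ᴴ * (E x - E (x + Pi.single i 1)) := by
  have hL2 : 2 ≤ L := by omega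
  have hhop : ∀ (x : TorusSite 3 L) (i : Fin 3), hop x (x + Pi.single i 1) =
      (1 / 2 : ℂ) • Pd x + (1 / 2 : ℂ) • Pd (x + Pi.single i 1) -
        (1 / 2 : ℂ) • ((E x - E (x + Pi.single i 1))ᴴ * (E x - E (x + Pi.single i 1))) := by
    intro x i
    have hne : x ≠ x + Pi.single i 1 := fun h =>
      torus_single_ne_zero hL2 i (left_eq_add.mp h)
    rw [hop_eq_sub hne, smul_add]
  have hshift : ∀ i : Fin 3,
      ∑ x : TorusSite 3 L, (1 / 2 : ℂ) • Pd (x + Pi.single i 1) =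
        ∑ x : TorusSite 3 L, (1 / 2 : ℂ) • Pd x := fun i =>
    Equiv.sum_comp (Equiv.addRight (Pi.single i 1)) (fun x => (1 / 2 : ℂ) • Pd x)
  have h2 : ∑ x : TorusSite 3 L, ∑ i : Fin 3, (1 / 2 : ℂ) • Pd (x + Pi.single i 1) =
      ∑ x : TorusSite 3 L, ∑ _i : Fin 3, (1 / 2 : ℂ) • Pd x := by
    rw [Finset.sum_comm]
    simp only [hshift]
    rw [Finset.sum_comm]
  rw [Hmu, xxz_eq L hL, totalSpin_two_eq]
  simp only [hhop, Finset.sum_sub_distrib, Finset.sum_add_distrib]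
  rw [h2]
  simp only [Finset.sum_const, Finset.card_univ, Fintype.card_fin, ← Finset.smul_sum]
  push_cast
  module

/-- The all-up vector is an eigenvector of `H_{L,μ}` with eigenvalue `−μ|Λ|/2`. [folklore] -/
theorem hmu_mulVec_upVec (hL : 3 ≤ L) (μ : ℝ) :
    Hmu L μ *ᵥ upVec = ((-(μ * Fintype.card (TorusSite 3 L) / 2) : ℝ) : ℂ) • upVec := by
  rw [hmu_decomp L hL μ, add_mulVec, add_mulVec, smul_mulVec, smul_mulVec,
    smul_mulVec, one_mulVec, Matrix.sum_mulVec, Matrix.sum_mulVec]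
  simp only [Matrix.sum_mulVec, ← mulVec_mulVec, sub_mulVec, E_mulVec_upVec, Pd_mulVec_upVec,
    sub_zero, mulVec_zero, Finset.sum_const_zero, smul_zero, add_zero]

/-- Variational bound: `E₀(H_{L,μ}) ≤ −μ|Λ|/2`. [folklore] -/
theorem groundEnergy_hmu_le (hL : 3 ≤ L) (μ : ℝ) :
    (Hmu L μ).groundEnergy ≤ -(μ * Fintype.card (TorusSite 3 L) / 2) := by
  have h := groundEnergy_le_rayleigh_holds (Hmu_isHermitian L μ) upVec
    star_upVec_dotProduct_upVec
  rwa [hmu_mulVec_upVec L hL μ, dotProduct_smul, star_upVec_dotProduct_upVec, smul_eq_mul,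
    mul_one, Complex.ofReal_re] at h

end Torus

/-! ### The `μ ↦ −μ` symmetry (π-rotation about the 1-axis on every site) -/

section Symmetry

variable {Λ : Type*} [Fintype Λ] [DecidableEq Λ]

/-- The global spin flip `U = ⨂_x σˣ_x` (rotation by `π` about the 1-axis, up to a phase):
`S¹ ↦ S¹`, `S² ↦ −S²`, `S³ ↦ −S³`; in boson language the particle–hole map. [folklore] -/
def flipOp : Op Λ 2 := productOp fun _ : Λ => spinHalfPauli 0

/-- `σˣ (σˣ)ᴴ = 1`. [folklore] -/
theorem pauliX_mul_conjTranspose : spinHalfPauli 0 * (spinHalfPauli 0)ᴴ = 1 := by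
  ext i j
  fin_cases i <;> fin_cases j <;> simp [spinHalfPauli, Matrix.mul_apply, conjTranspose_apply]

/-- `(σˣ)ᴴ σˣ = 1`. [folklore] -/
theorem pauliX_conjTranspose_mul : (spinHalfPauli 0)ᴴ * spinHalfPauli 0 = 1 := by
  ext i j
  fin_cases i <;> fin_cases j <;> simp [spinHalfPauli, Matrix.mul_apply, conjTranspose_apply]

/-- `σˣ σ^α (σˣ)ᴴ = ε_α σ^α` with `ε = (1, −1, −1)`. [folklore] -/
theorem pauliX_conj_spinHalfPauli (α : Fin 3) :
    spinHalfPauli 0 * spinHalfPauli α * (spinHalfPauli 0)ᴴ =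
      (if α = 0 then (1 : ℂ) else -1) • spinHalfPauli α := by
  ext i j
  fin_cases α <;> fin_cases i <;> fin_cases j <;>
    simp [spinHalfPauli, Matrix.mul_apply, conjTranspose_apply]

/-- `σˣ S^α (σˣ)ᴴ = ε_α S^α` for spin ½. [folklore] -/
theorem pauliX_conj_spinVec (α : Fin 3) :
    spinHalfPauli 0 * spinVec 1 α * (spinHalfPauli 0)ᴴ =
      (if α = 0 then (1 : ℂ) else -1) • spinVec 1 α := by
  rw [spinVec_one_eq_half_spinHalfPauli, Matrix.mul_smul, Matrix.smul_mul,
    pauliX_conj_spinHalfPauli, smul_comm]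

/-- `U S^α_x Uᴴ = ε_α S^α_x`. [folklore] -/
theorem flip_conj_siteSpin (x : Λ) (α : Fin 3) :
    flipOp * siteSpin 1 x α * flipOpᴴ = (if α = 0 then (1 : ℂ) else -1) • siteSpin 1 x α := by
  rw [flipOp, productOp_conj_siteSpin (fun _ => pauliX_mul_conjTranspose), pauliX_conj_spinVec,
    onSite_smul', siteSpin]

/-- The XY bond operator is flip-invariant: `U (S¹_xS¹_y + S²_xS²_y) Uᴴ = S¹_xS¹_y + S²_xS²_y`.
[folklore] -/
theorem flip_conj_hop (x y : Λ) : flipOp * hop x y * flipOpᴴ = hop x y := by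
  have hu : ∀ _z : Λ, (spinHalfPauli 0)ᴴ * spinHalfPauli 0 = 1 := fun _ => pauliX_conjTranspose_mul
  rw [hop, Matrix.mul_add, Matrix.add_mul, flipOp, productOp_conj_mul hu, productOp_conj_mul hu,
    ← flipOp, flip_conj_siteSpin, flip_conj_siteSpin, flip_conj_siteSpin, flip_conj_siteSpin]
  simp

/-- `U S³_tot Uᴴ = −S³_tot`. [folklore] -/
theorem flip_conj_totalSpin_two : flipOp * (totalSpin 1 2 : Op Λ 2) * flipOpᴴ = -totalSpin 1 2 := by
  unfold totalSpin
  rw [Finset.mul_sum, Finset.sum_mul, ← Finset.sum_neg_distrib]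
  refine Finset.sum_congr rfl fun x _ => ?_
  rw [flip_conj_siteSpin]
  simp

/-- `U Uᴴ = 1`. [folklore] -/
theorem flipOp_mul_conjTranspose : (flipOp : Op Λ 2) * flipOpᴴ = 1 :=
  productOp_mul_conjTranspose fun _ => pauliX_mul_conjTranspose

/-- `Uᴴ U = 1`. [folklore] -/
theorem flipOp_conjTranspose_mul : (flipOp : Op Λ 2)ᴴ * flipOp = 1 :=
  productOp_conjTranspose_mul fun _ => pauliX_conjTranspose_mul

variable (L : ℕ) [NeZero L]

/-- **`U H_{L,μ} Uᴴ = H_{L,−μ}`** (`L ≥ 3`): the flip reverses the chemical potential. [folklore] -/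
theorem flip_conj_hmu (hL : 3 ≤ L) (μ : ℝ) : flipOp * Hmu L μ * flipOpᴴ = Hmu L (-μ) := by
  rw [Hmu, Hmu, xxz_eq L hL, Matrix.mul_sub, Matrix.sub_mul, Matrix.mul_smul, Matrix.smul_mul,
    flip_conj_totalSpin_two, Matrix.mul_neg, Matrix.neg_mul, Finset.mul_sum, Finset.sum_mul]
  simp_rw [Finset.mul_sum, Finset.sum_mul, flip_conj_hop]
  rw [Complex.ofReal_neg, neg_smul, smul_neg]

/-- **The crux's two-point function is even in `μ`** (`L ≥ 3`):
`Re Σ_α ω_{L,−μ}(S^α_xS^α_y) = Re Σ_α ω_{L,μ}(S^α_xS^α_y)` (covariance of the tracial ground state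
under the flip, `groundStateFunctional_unitary_conj`). So provers may assume `μ > 0`. [folklore] -/
theorem corr_neg_mu (hL : 3 ≤ L) (μ : ℝ) (x y : TorusSite 3 L) :
    (∑ α : Fin 2, (Hmu L (-μ)).groundStateFunctional
        (siteSpin 1 x (Fin.castSucc α) * siteSpin 1 y (Fin.castSucc α))).re =
      (∑ α : Fin 2, (Hmu L μ).groundStateFunctional
        (siteSpin 1 x (Fin.castSucc α) * siteSpin 1 y (Fin.castSucc α))).re := by
  rw [Fin.sum_univ_two, Fin.sum_univ_two, ← map_add, ← map_add]
  change ((Hmu L (-μ)).groundStateFunctional (hop x y)).re =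
    ((Hmu L μ).groundStateFunctional (hop x y)).re
  rw [← flip_conj_hmu L hL μ]
  conv_lhs => rw [← flip_conj_hop x y]
  rw [groundStateFunctional_unitary_conj flipOp_mul_conjTranspose flipOp_conjTranspose_mul]

end Symmetry

/-! ### Ground-state consequences above saturation (`μ > 3`) -/

section Saturated

variable (L : ℕ) [NeZero L]

/-- Above the saturation field no site is ever down in the (tracial) ground state:
`Re ω(P↓_x) = 0` for every `x` (`L ≥ 3`, `μ > 3`). Proof = the SOS certificate `hmu_decomp`
evaluated in `ω` against the variational bound `groundEnergy_hmu_le`. [folklore] -/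
theorem re_gsf_Pd_eq_zero (hL : 3 ≤ L) {μ : ℝ} (hμ : 3 < μ) (x : TorusSite 3 L) :
    ((Hmu L μ).groundStateFunctional (Pd x)).re = 0 := by
  have hH : (Hmu L μ).IsHermitian := Hmu_isHermitian L μ
  set ω := (Hmu L μ).groundStateFunctional with hω
  have hP : ∀ z : TorusSite 3 L, 0 ≤ (ω (Pd z)).re := fun z => by
    rw [← E_conjTranspose_mul_E]
    exact (Complex.nonneg_iff.mp (groundStateFunctional_nonneg (Hmu L μ) (E z))).1
  have hQ : ∀ (z : TorusSite 3 L) (i : Fin 3),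
      0 ≤ (ω ((E z - E (z + Pi.single i 1))ᴴ * (E z - E (z + Pi.single i 1)))).re := fun z i =>
    (Complex.nonneg_iff.mp (groundStateFunctional_nonneg (Hmu L μ) _)).1
  have hE : ω (Hmu L μ) = ((Hmu L μ).groundEnergy : ℂ) := groundStateFunctional_hamiltonian hH
  have h1 : ω 1 = 1 := groundStateFunctional_one hH
  have hdec := congrArg (fun A => (ω A).re) (hmu_decomp L hL μ)
  simp only [map_add, LinearMap.map_smul, map_sum, smul_eq_mul, h1, mul_one, Complex.add_re,
    Complex.re_ofReal_mul, Complex.re_sum, hE, Complex.ofReal_re] at hdec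
  have hle := groundEnergy_hmu_le L hL μ
  have hsumQ : 0 ≤ ∑ z : TorusSite 3 L, ∑ i : Fin 3,
      (ω ((E z - E (z + Pi.single i 1))ᴴ * (E z - E (z + Pi.single i 1)))).re :=
    Finset.sum_nonneg fun z _ => Finset.sum_nonneg fun i _ => hQ z i
  have hsumP : ∑ z : TorusSite 3 L, (ω (Pd z)).re ≤ 0 := by
    by_contra hcon
    push Not at hcon
    have : 0 < (μ - 3) * ∑ z : TorusSite 3 L, (ω (Pd z)).re := mul_pos (by linarith) hcon
    linarith
  have hsum0 : ∑ z : TorusSite 3 L, (ω (Pd z)).re = 0 :=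
    le_antisymm hsumP (Finset.sum_nonneg fun z _ => hP z)
  exact (Finset.sum_eq_zero_iff_of_nonneg (fun z _ => hP z)).mp hsum0 x (Finset.mem_univ x)

/-- **The hopping correlation above saturation**: `Re ω(S¹_xS¹_y + S²_xS²_y) = ½δ_{xy}`
(`L ≥ 3`, `μ > 3`): off the diagonal both SOS identities `hop_eq_sub`, `hop_eq_add` and
`Re ω(P↓) = 0` squeeze it to `0`; on the diagonal `(S^α)² = ¼`. [folklore] -/
theorem re_gsf_hop_eq (hL : 3 ≤ L) {μ : ℝ} (hμ : 3 < μ) (x y : TorusSite 3 L) :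
    ((Hmu L μ).groundStateFunctional (hop x y)).re = if x = y then 1 / 2 else 0 := by
  have hH : (Hmu L μ).IsHermitian := Hmu_isHermitian L μ
  set ω := (Hmu L μ).groundStateFunctional with hω
  have h1 : ω 1 = 1 := groundStateFunctional_one hH
  have hhalf : (1 / 2 : ℂ) = ((1 / 2 : ℝ) : ℂ) := by norm_num
  split_ifs with hxy
  · subst hxy
    rw [hop, siteSpin_mul_self, siteSpin_mul_self, ← add_smul, LinearMap.map_smul, h1,
      smul_eq_mul, mul_one]
    norm_num
  · have hPx := re_gsf_Pd_eq_zero L hL hμ x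
    have hPy := re_gsf_Pd_eq_zero L hL hμ y
    have hup : (ω (hop x y)).re ≤ 0 := by
      have key := hop_eq_sub hxy
      rw [hhalf] at key
      have h := congrArg (fun A => (ω A).re) key
      simp only [map_sub, map_add, LinearMap.map_smul, smul_eq_mul, Complex.sub_re,
        Complex.add_re, Complex.re_ofReal_mul] at h
      have hQ := (Complex.nonneg_iff.mp (groundStateFunctional_nonneg (Hmu L μ) (E x - E y))).1
      rw [h, hPx, hPy]
      linarith
    have hlo : 0 ≤ (ω (hop x y)).re := by
      have key := hop_eq_add hxy
      rw [hhalf] at key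
      have h := congrArg (fun A => (ω A).re) key
      simp only [map_sub, map_add, LinearMap.map_smul, smul_eq_mul, Complex.sub_re,
        Complex.add_re, Complex.re_ofReal_mul] at h
      have hQ := (Complex.nonneg_iff.mp (groundStateFunctional_nonneg (Hmu L μ) (E x + E y))).1
      rw [h, hPx, hPy]
      linarith
    exact le_antisymm hup hlo

/-- **The crux's two-point function above saturation, in closed form**: for `L ≥ 3` and
`μ > 3`, `Re Σ_{α=1,2} ω_{H_{L,μ}}(S^α_x S^α_y) = ½ δ_{xy}` — no off-diagonal order at all,
let alone long-range order. [folklore] -/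
theorem corr_eq (hL : 3 ≤ L) {μ : ℝ} (hμ : 3 < μ) (x y : TorusSite 3 L) :
    (∑ α : Fin 2, (Hmu L μ).groundStateFunctional
        (siteSpin 1 x (Fin.castSucc α) * siteSpin 1 y (Fin.castSucc α))).re =
      if x = y then 1 / 2 else 0 := by
  rw [Fin.sum_univ_two, ← map_add]
  exact re_gsf_hop_eq L hL hμ x y

end Saturated

/-! ### The crux, its `μ`-slices, and the refuted strengthening -/

section Crux

/-- The `μ`-slice of the crux: long-range order of the tracial ground states of `H_{L,μ}` along
the even tori `(ℤ/2kℤ)³` — VERBATIM the matrix of `LatticeODLROOffHalfFilling` after `∀ μ`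
(a definition, the crux's own predicate sliced at `μ`; not a cited fact). -/
def LROAt (μ : ℝ) : Prop :=
  0 < Filter.liminf (fun k : ℕ => (∑ x ∈ halfOpenBox 3 (2 * k), ∑ y ∈ halfOpenBox 3 (2 * k),
    torusPullback (d := 3) (fun L x y => if hL : L = 0 then 0 else (haveI : NeZero L := ⟨hL⟩;
      (∑ α : Fin 2, (xxzHamiltonian 1 (torusGraph 3 L) (-1) 0 -
        (μ : ℂ) • totalSpin 1 2).groundStateFunctional
        (siteSpin 1 x (Fin.castSucc α) * siteSpin 1 y (Fin.castSucc α))).re)) (2 * k) x y) /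
      ((halfOpenBox 3 (2 * k)).card : ℝ) ^ 2) Filter.atTop

/-- The crux is `∃ μ₀ > 0, ∀ |μ| < μ₀, LROAt μ` — definitionally. [folklore] -/
theorem latticeODLRO_iff :
    Theses.BECGroundStateSOS.LatticeODLROOffHalfFilling ↔
      ∃ μ₀ : ℝ, 0 < μ₀ ∧ ∀ μ : ℝ, |μ| < μ₀ → LROAt μ := Iff.rfl

/-- **Calibration (μ = 0 is PROVED):** the half-filling slice of the crux is exactly the in-tree
Kennedy–Lieb–Shastry theorem (`d = 3`, `S = ½`): the sign conventions, the component indexing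
(`Fin.castSucc` vs `Fin.castLE`) and the normalisation of the crux agree with `XYOrder.lean`.
[cite: KLS1988PRL, Theorem] -/
theorem lroAt_zero : LROAt 0 := by
  have h := kennedy_lieb_shastry_xy_ground_holds 3 (by norm_num) 1 le_rfl
  unfold HasEvenTorusLRO groundStateXYCorrTorus HasLongRangeOrder at h
  unfold LROAt
  simp only [Complex.ofReal_zero, zero_smul, sub_zero]
  exact h

/-- **The normalised order parameter above saturation, exactly**: for `μ > 3` and `k ≥ 2` the
`k`-th term of the crux's `liminf` is `|Λ|/2 / |Λ|² = 1/(16 k³)`. [folklore] -/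
theorem orderParam_eq {μ : ℝ} (hμ : 3 < μ) {k : ℕ} (hk : 2 ≤ k) :
    (∑ x ∈ halfOpenBox 3 (2 * k), ∑ y ∈ halfOpenBox 3 (2 * k),
      torusPullback (d := 3) (fun L x y => if hL : L = 0 then 0 else (haveI : NeZero L := ⟨hL⟩;
        (∑ α : Fin 2, (xxzHamiltonian 1 (torusGraph 3 L) (-1) 0 -
          (μ : ℂ) • totalSpin 1 2).groundStateFunctional
          (siteSpin 1 x (Fin.castSucc α) * siteSpin 1 y (Fin.castSucc α))).re)) (2 * k) x y) /
      ((halfOpenBox 3 (2 * k)).card : ℝ) ^ 2 = 1 / (16 * (k : ℝ) ^ 3) := by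
  have hL0 : 2 * k ≠ 0 := by omega
  haveI : NeZero (2 * k) := ⟨hL0⟩
  have hL3 : 3 ≤ 2 * k := by omega
  have hcard : Fintype.card (TorusSite 3 (2 * k)) = (2 * k) ^ 3 := by
    simp [ZMod.card, Fintype.card_fin]
  simp only [torusPullback_apply, dif_neg hL0]
  rw [sum_sq_halfOpenBox_comp_torusProj (fun s t : TorusSite 3 (2 * k) =>
    (∑ α : Fin 2, (Hmu (2 * k) μ).groundStateFunctional
      (siteSpin 1 s (Fin.castSucc α) * siteSpin 1 t (Fin.castSucc α))).re)]
  simp only [corr_eq (2 * k) hL3 hμ, Finset.sum_ite_eq, Finset.mem_univ, if_true,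
    Finset.sum_const, Finset.card_univ, hcard, card_halfOpenBox, nsmul_eq_mul]
  push_cast
  have hk0 : (k : ℝ) ≠ 0 := by exact_mod_cast (show k ≠ 0 by omega)
  field_simp
  ring

/-- **REFUTED STRENGTHENING / load-bearing smallness of `μ`.** No slice above the saturation
field has long-range order: `¬ LROAt μ` for every `μ > 3`. Witness: the fully polarised product
state is the unique ground state of `H_{L,μ}` for `μ > 3` (SOS certificate `hmu_decomp`), its
order parameter is `1/(16k³) → 0`. [folklore] -/
theorem not_lroAt_of_three_lt {μ : ℝ} (hμ : 3 < μ) : ¬ LROAt μ := by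
  intro h
  unfold LROAt at h
  obtain ⟨f, hf, hfk⟩ : ∃ f : ℕ → ℝ, 0 < Filter.liminf f Filter.atTop ∧
      ∀ k : ℕ, 2 ≤ k → f k = 1 / (16 * (k : ℝ) ^ 3) :=
    ⟨_, h, fun k hk => orderParam_eq hμ hk⟩
  have hlim : Filter.Tendsto (fun k : ℕ => 1 / (16 * (k : ℝ) ^ 3)) Filter.atTop (nhds 0) :=
    tendsto_const_nhds.div_atTop (Filter.Tendsto.const_mul_atTop (by norm_num)
      ((Filter.tendsto_pow_atTop (by norm_num)).comp tendsto_natCast_atTop_atTop))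
  have hlim' : Filter.Tendsto f Filter.atTop (nhds 0) :=
    hlim.congr' ((Filter.eventually_ge_atTop 2).mono fun k hk => (hfk k hk).symm)
  rw [hlim'.liminf_eq] at hf
  exact lt_irrefl 0 hf

/-- **Any proof of the crux must use `|μ| < μ₀` with `μ₀ ≤ 3`**: the strengthening to all `μ`
is false (witness `μ = 4`, above the saturation field `|μ| = 3` of the `S = ½` XY model on the
cubic lattice, coordination number `6`); `∀ μ, LROAt μ` is the crux with the smallness hypothesis
`|μ| < μ₀` dropped. [folklore] -/
theorem latticeODLRO_false_without_smallMu : ¬ ∀ μ : ℝ, LROAt μ := fun h =>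
  not_lroAt_of_three_lt (by norm_num : (3 : ℝ) < 4) (h 4)

/-- Equivalent reading: whatever `μ₀` a proof of the crux produces satisfies `μ₀ ≤ 3`
(the window cannot reach past saturation). [folklore] -/
theorem mu0_le_three {μ₀ : ℝ} (h : ∀ μ : ℝ, |μ| < μ₀ → LROAt μ) : μ₀ ≤ 3 := by
  by_contra hlt
  push Not at hlt
  obtain ⟨μ, h3, hμ⟩ : ∃ μ : ℝ, 3 < μ ∧ μ < μ₀ := exists_between hlt
  exact not_lroAt_of_three_lt h3 (h μ (by rw [abs_of_pos (by linarith)]; exact hμ))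

/-- **Each `liminf` term of the crux is `≥ 0`** (every `μ`, every `k`): the double sum is
`Re Σ_α ω((S^α_tot)²) ≥ 0` by positivity of the tracial ground state. So `¬ LROAt μ` means the
`liminf` is exactly `0`, never negative, and no finite-`k` computation can refute the crux. [folklore] -/
theorem orderParam_nonneg (μ : ℝ) (k : ℕ) :
    0 ≤ (∑ x ∈ halfOpenBox 3 (2 * k), ∑ y ∈ halfOpenBox 3 (2 * k),
      torusPullback (d := 3) (fun L x y => if hL : L = 0 then 0 else (haveI : NeZero L := ⟨hL⟩;
        (∑ α : Fin 2, (xxzHamiltonian 1 (torusGraph 3 L) (-1) 0 -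
          (μ : ℂ) • totalSpin 1 2).groundStateFunctional
          (siteSpin 1 x (Fin.castSucc α) * siteSpin 1 y (Fin.castSucc α))).re)) (2 * k) x y) /
      ((halfOpenBox 3 (2 * k)).card : ℝ) ^ 2 := by
  refine div_nonneg ?_ (by positivity)
  rcases Nat.eq_zero_or_pos k with rfl | hk
  · simp
  have hL0 : 2 * k ≠ 0 := by omega
  haveI : NeZero (2 * k) := ⟨hL0⟩
  simp only [torusPullback_apply, dif_neg hL0]
  rw [sum_sq_halfOpenBox_comp_torusProj (fun s t : TorusSite 3 (2 * k) =>
    (∑ α : Fin 2, (Hmu (2 * k) μ).groundStateFunctional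
      (siteSpin 1 s (Fin.castSucc α) * siteSpin 1 t (Fin.castSucc α))).re)]
  set ω := (Hmu (2 * k) μ).groundStateFunctional with hω
  have hH : ∀ α : Fin 3, (∑ s : TorusSite 3 (2 * k), siteSpin 1 s α).IsHermitian := fun α => by
    rw [IsHermitian, Matrix.conjTranspose_sum]
    exact Finset.sum_congr rfl fun x _ => (siteSpin_isHermitian 1 x α).eq
  have key : ∀ α : Fin 3, 0 ≤ (ω ((∑ s : TorusSite 3 (2 * k), siteSpin 1 s α) *
      ∑ t : TorusSite 3 (2 * k), siteSpin 1 t α)).re := fun α =>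
    re_groundStateFunctional_mul_self_nonneg _ (hH α)
  have step : ∀ α : Fin 3, (ω ((∑ s : TorusSite 3 (2 * k), siteSpin 1 s α) *
      ∑ t : TorusSite 3 (2 * k), siteSpin 1 t α)).re =
      ∑ s : TorusSite 3 (2 * k), ∑ t : TorusSite 3 (2 * k), (ω (siteSpin 1 s α * siteSpin 1 t α)).re := by
    intro α
    simp only [Finset.sum_mul_sum, map_sum, Complex.re_sum]
  have hre : ∀ s t : TorusSite 3 (2 * k), (∑ α : Fin 2, ω (siteSpin 1 s (Fin.castSucc α) *
      siteSpin 1 t (Fin.castSucc α))).re = ∑ α : Fin 2, (ω (siteSpin 1 s (Fin.castSucc α) *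
      siteSpin 1 t (Fin.castSucc α))).re := fun s t => Complex.re_sum _ _
  simp only [hre]
  calc (0 : ℝ) ≤ ∑ α : Fin 2, (ω ((∑ s : TorusSite 3 (2 * k), siteSpin 1 s (Fin.castSucc α)) *
        ∑ t : TorusSite 3 (2 * k), siteSpin 1 t (Fin.castSucc α))).re :=
        Finset.sum_nonneg fun α _ => key _
    _ = ∑ α : Fin 2, ∑ s : TorusSite 3 (2 * k), ∑ t : TorusSite 3 (2 * k),
          (ω (siteSpin 1 s (Fin.castSucc α) * siteSpin 1 t (Fin.castSucc α))).re :=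
        Finset.sum_congr rfl fun α _ => step _
    _ = ∑ s : TorusSite 3 (2 * k), ∑ t : TorusSite 3 (2 * k), ∑ α : Fin 2,
          (ω (siteSpin 1 s (Fin.castSucc α) * siteSpin 1 t (Fin.castSucc α))).re := by
        rw [Finset.sum_comm]
        exact Finset.sum_congr rfl fun s _ => Finset.sum_comm

/-- **`LROAt` is even in `μ`**: the `k`-th liminf terms agree for `k ≥ 2` (`corr_neg_mu`).
[folklore] -/
theorem lroAt_neg_iff (μ : ℝ) : LROAt (-μ) ↔ LROAt μ := by
  unfold LROAt
  rw [Filter.liminf_congr]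
  filter_upwards [Filter.eventually_ge_atTop 2] with k hk
  have hL0 : 2 * k ≠ 0 := by omega
  haveI : NeZero (2 * k) := ⟨hL0⟩
  have hL3 : 3 ≤ 2 * k := by omega
  simp only [torusPullback_apply, dif_neg hL0, corr_neg_mu (2 * k) hL3 μ]

/-- Hence no ODLRO below `μ < −3` either (full lattice = empty lattice of holes). [folklore] -/
theorem not_lroAt_of_lt_neg_three {μ : ℝ} (hμ : μ < -3) : ¬ LROAt μ := by
  rw [← neg_neg μ, lroAt_neg_iff]
  exact not_lroAt_of_three_lt (by linarith)

/-- The surviving window is symmetric: `(∀ |μ| < μ₀, LROAt μ) ↔ (∀ μ, 0 ≤ μ → μ < μ₀ → LROAt μ)`.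
[folklore] -/
theorem forall_abs_lt_iff (μ₀ : ℝ) :
    (∀ μ : ℝ, |μ| < μ₀ → LROAt μ) ↔ ∀ μ : ℝ, 0 ≤ μ → μ < μ₀ → LROAt μ := by
  constructor
  · intro h μ h0 h1
    exact h μ (by rwa [abs_of_nonneg h0])
  · intro h μ hμ
    rcases le_or_gt 0 μ with h0 | h0
    · exact h μ h0 (lt_of_abs_lt hμ)
    · rw [← lroAt_neg_iff]
      exact h (-μ) (by linarith) (by rwa [abs_of_neg h0] at hμ)

end Crux



/-! ### The boundary point `|μ| = 3` (tightness): no ODLRO AT saturation either -/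

section Boundary

/-- **Positivity transfer from the ground space to the tracial ground state**: if the quadratic
form of `T` is `≥ 0` (real part) on the ground space of `A`, then `Re ω_A(T) ≥ 0`
(`tr(P₀T) = tr(P₀TP₀) = Σ_σ ⟨P₀e_σ, T P₀e_σ⟩`). [folklore] -/
theorem re_gsf_nonneg_of_groundSpace {m : Type*} [Fintype m] [DecidableEq m]
    {A T : Matrix m m ℂ} (hT : ∀ v ∈ A.groundSpace, 0 ≤ (star v ⬝ᵥ T *ᵥ v).re) :
    0 ≤ (A.groundStateFunctional T).re := by
  rw [groundStateFunctional_apply]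
  set P := A.groundProj with hPdef
  have hP : Pᴴ = P := (groundProj_isHermitian A).eq
  have hPP : P * P = P := groundProj_mul_self A
  have h1 : (P * T).trace = (Pᴴ * T * P).trace := by
    rw [hP]
    calc (P * T).trace = (T * P).trace := trace_mul_comm _ _
      _ = (T * (P * P)).trace := by rw [hPP]
      _ = (T * P * P).trace := by rw [Matrix.mul_assoc]
      _ = (P * (T * P)).trace := trace_mul_comm _ _
      _ = (P * T * P).trace := by rw [Matrix.mul_assoc]
  have htr : (P * T).trace = ∑ σ, star (P.col σ) ⬝ᵥ T *ᵥ (P.col σ) := by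
    rw [h1]
    simp only [Matrix.trace, Matrix.diag, Matrix.mul_apply, dotProduct, mulVec, Matrix.col_apply,
      Pi.star_apply, conjTranspose_apply, Finset.sum_mul, Finset.mul_sum]
    refine Finset.sum_congr rfl fun σ _ => ?_
    rw [Finset.sum_comm]
    refine Finset.sum_congr rfl fun a _ => Finset.sum_congr rfl fun b _ => ?_
    ring
  have hcol : ∀ σ, P.col σ ∈ A.groundSpace := fun σ => by
    rw [← mulVec_single_one]
    exact groundProj_mulVec_mem A _
  have hre : 0 ≤ ((P * T).trace).re := by
    rw [htr, Complex.re_sum]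
    exact Finset.sum_nonneg fun σ _ => hT _ (hcol σ)
  have hZ : 0 ≤ P.trace := (posSemidef_groundProj A).trace_nonneg
  obtain ⟨hZre, hZim⟩ := Complex.nonneg_iff.mp hZ
  rw [Complex.mul_re, Complex.inv_re, Complex.inv_im, ← hZim]
  simp only [neg_zero, zero_div, zero_mul, sub_zero]
  exact mul_nonneg (div_nonneg hZre (Complex.normSq_nonneg _)) hre

variable {Λ : Type*} [Fintype Λ] [DecidableEq Λ]

/-- `star v ⬝ᵥ (Cᴴ C) v = ‖C v‖²`. [folklore] -/
theorem star_dotProduct_conjTranspose_mul_mulVec {m : Type*} [Fintype m] (C : Matrix m m ℂ)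
    (v : m → ℂ) : star v ⬝ᵥ (Cᴴ * C) *ᵥ v = star (C *ᵥ v) ⬝ᵥ (C *ᵥ v) := by
  rw [← mulVec_mulVec, dotProduct_mulVec, ← star_mulVec]

/-- Entries of `S⁺_x w`: `(S⁺_x w)(σ) = [σ_x = ↑] · w(σ with x ↓)`. [folklore] -/
theorem E_mulVec_apply (x : Λ) (w : TensorIndex Λ 2 → ℂ) (σ : TensorIndex Λ 2) :
    (E x *ᵥ w) σ = if σ x = 0 then w (Function.update σ x 1) else 0 := by
  rw [E, LiebMattis.onSite_mulVec_apply, Fin.sum_univ_two]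
  have h0 : ∀ k : Fin 2, raise k 0 = 0 := by
    intro k; fin_cases k <;> simp [raise]
  have h1 : ∀ k : Fin 2, raise k 1 = if k = 0 then 1 else 0 := by
    intro k; fin_cases k <;> simp [raise]
  rw [h0, h1, zero_mul, zero_add]
  split_ifs <;> simp

/-- `(S⁺_x)² = 0` for spin ½. [folklore] -/
theorem E_mul_E (x : Λ) : E x * E x = (0 : Op Λ 2) := by
  rw [E, onSite_mul]
  have : raise * raise = 0 := by
    ext i j; fin_cases i <;> fin_cases j <;> simp [raise, Matrix.mul_apply]
  rw [this]
  ext σ τ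
  simp [onSite_apply]

/-- A vector killed by every `S⁺_y` is a multiple of the all-up vector. [folklore] -/
theorem eq_smul_upVec_of_forall_E_mulVec_eq_zero (w : TensorIndex Λ 2 → ℂ)
    (h : ∀ y : Λ, E y *ᵥ w = 0) : w = w (fun _ => 0) • upVec := by
  ext τ
  by_cases hτ : τ = fun _ => 0
  · subst hτ
    simp [upVec]
  · obtain ⟨y, hy⟩ : ∃ y, τ y ≠ 0 := by
      by_contra hcon
      push Not at hcon
      exact hτ (funext hcon)
    have hy1 : τ y = 1 := by
      rcases Fin.exists_fin_two.mp ⟨τ y, rfl⟩ with h0 | h1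
      · exact absurd h0 hy
      · exact h1
    have key := congrFun (h y) (Function.update τ y 0)
    rw [E_mulVec_apply, Pi.zero_apply, if_pos (Function.update_self _ _ _),
      Function.update_idem, ← hy1, Function.update_eq_self] at key
    rw [key, Pi.smul_apply, upVec, Pi.single_apply, if_neg hτ, smul_zero]

/-- `e eᴴ − eᴴ e = σᶻ = 2S³` for spin ½. [folklore] -/
theorem raise_mul_conjTranspose_sub : raise * raiseᴴ - raiseᴴ * raise = (2 : ℂ) • spinVec 1 2 := by
  have hct : raiseᴴ = !![0, 0; 1, 0] := by
    ext i j; fin_cases i <;> fin_cases j <;> simp [raise, conjTranspose_apply]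
  rw [hct, spinVec_one_eq_half_spinHalfPauli, smul_smul, spinHalfPauli_two_eq]
  ext i j
  fin_cases i <;> fin_cases j <;> norm_num [raise, pDown, Matrix.mul_apply, Fin.sum_univ_two]

/-- The commutator `S⁺_xS⁻_x − S⁻_xS⁺_x = 2S³_x`. [folklore] -/
theorem E_mul_conjTranspose_sub (x : Λ) : E x * (E x)ᴴ - (E x)ᴴ * E x = (2 : ℂ) • siteSpin 1 x 2 := by
  rw [E_conjTranspose, E, onSite_mul, onSite_mul, ← onSite_sub', raise_mul_conjTranspose_sub,
    onSite_smul', siteSpin]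

/-- **The order-parameter operator**: `Σ_{x,y}(S¹_xS¹_y + S²_xS²_y) = (S⁺_tot)ᴴ S⁺_tot + S³_tot`.
[folklore] -/
theorem sum_hop_eq :
    ∑ x : Λ, ∑ y : Λ, hop x y = (∑ x : Λ, E x)ᴴ * (∑ x : Λ, E x) + totalSpin 1 2 := by
  have hcomm : ∀ x y : Λ, x ≠ y → E x * (E y)ᴴ = (E y)ᴴ * E x := fun x y hxy => by
    rw [E_conjTranspose, E, onSite_mul_onSite_comm hxy]
  have h1 : ∑ x : Λ, ∑ y : Λ, E x * (E y)ᴴ =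
      ∑ x : Λ, ∑ y : Λ, (E y)ᴴ * E x + (2 : ℂ) • totalSpin 1 2 := by
    unfold totalSpin
    rw [Finset.smul_sum, ← Finset.sum_add_distrib]
    refine Finset.sum_congr rfl fun x _ => ?_
    rw [← E_mul_conjTranspose_sub, ← Finset.sum_erase_add _ _ (Finset.mem_univ x),
      ← Finset.sum_erase_add (Finset.univ) (fun y => (E y)ᴴ * E x) (Finset.mem_univ x)]
    rw [add_assoc, add_sub_cancel, Finset.sum_congr rfl fun y hy => hcomm x y
      (Finset.ne_of_mem_erase hy).symm]
  have h2 : ∑ x : Λ, ∑ y : Λ, (E y)ᴴ * E x = (∑ x : Λ, E x)ᴴ * ∑ x : Λ, E x := by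
    rw [Matrix.conjTranspose_sum, Finset.sum_mul_sum, Finset.sum_comm]
  calc ∑ x : Λ, ∑ y : Λ, hop x y
      = ∑ x : Λ, ∑ y : Λ, (1 / 2 : ℂ) • (E x * (E y)ᴴ + (E x)ᴴ * E y) :=
        Finset.sum_congr rfl fun x _ => Finset.sum_congr rfl fun y _ => hop_eq x y
    _ = (1 / 2 : ℂ) • (∑ x : Λ, ∑ y : Λ, E x * (E y)ᴴ + ∑ x : Λ, ∑ y : Λ, (E x)ᴴ * E y) := by
        simp only [Finset.smul_sum, smul_add, Finset.sum_add_distrib]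
    _ = (1 / 2 : ℂ) • ((∑ x : Λ, E x)ᴴ * (∑ x : Λ, E x) + (2 : ℂ) • totalSpin 1 2 +
          (∑ x : Λ, E x)ᴴ * ∑ x : Λ, E x) := by
        rw [h1, h2, Matrix.conjTranspose_sum, Finset.sum_mul_sum]
    _ = (∑ x : Λ, E x)ᴴ * (∑ x : Λ, E x) + totalSpin 1 2 := by module

/-- `Re ⟨v, S³_tot v⟩ ≤ (|Λ|/2)‖v‖²` (`S³_tot = |Λ|/2 − N↓`, `N↓ = Σ (S⁺)ᴴS⁺ ≥ 0`). [folklore] -/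
theorem re_totalSpin_two_quad_le (v : TensorIndex Λ 2 → ℂ) :
    (star v ⬝ᵥ (totalSpin 1 2 : Op Λ 2) *ᵥ v).re ≤
      (Fintype.card Λ : ℝ) / 2 * (star v ⬝ᵥ v).re := by
  rw [totalSpin_two_eq, sub_mulVec, smul_mulVec, one_mulVec, dotProduct_sub, dotProduct_smul,
    Matrix.sum_mulVec, dotProduct_sum, Complex.sub_re, smul_eq_mul, Complex.re_sum]
  have hP : ∀ x : Λ, 0 ≤ (star v ⬝ᵥ Pd x *ᵥ v).re := fun x => by
    rw [← E_conjTranspose_mul_E, star_dotProduct_conjTranspose_mul_mulVec]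
    exact (Complex.nonneg_iff.mp (dotProduct_star_self_nonneg _)).1
  have hsum : 0 ≤ ∑ x : Λ, (star v ⬝ᵥ Pd x *ᵥ v).re := Finset.sum_nonneg fun x _ => hP x
  have hcast : (((Fintype.card Λ : ℂ) / 2) * (star v ⬝ᵥ v)).re =
      (Fintype.card Λ : ℝ) / 2 * (star v ⬝ᵥ v).re := by
    rw [show ((Fintype.card Λ : ℂ) / 2) = (((Fintype.card Λ : ℝ) / 2 : ℝ) : ℂ) by push_cast; ring,
      Complex.re_ofReal_mul]
  rw [hcast]
  linarith

variable (L : ℕ) [NeZero L]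

/-- `E₀(H_{L,3}) = −3|Λ|/2` (`L ≥ 3`): the certificate `hmu_decomp` at `μ = 3` has no `N↓` term.
[folklore] -/
theorem groundEnergy_hmu_three (hL : 3 ≤ L) :
    (Hmu L 3).groundEnergy = -(3 * Fintype.card (TorusSite 3 L) / 2) := by
  refine le_antisymm (groundEnergy_hmu_le L hL 3) ?_
  have hH : (Hmu L 3).IsHermitian := Hmu_isHermitian L 3
  set ω := (Hmu L 3).groundStateFunctional with hω
  have hE : ω (Hmu L 3) = ((Hmu L 3).groundEnergy : ℂ) := groundStateFunctional_hamiltonian hH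
  have h1 : ω 1 = 1 := groundStateFunctional_one hH
  have hQ : ∀ (z : TorusSite 3 L) (i : Fin 3),
      0 ≤ (ω ((E z - E (z + Pi.single i 1))ᴴ * (E z - E (z + Pi.single i 1)))).re := fun z i =>
    (Complex.nonneg_iff.mp (groundStateFunctional_nonneg (Hmu L 3) _)).1
  have hdec := congrArg (fun A => (ω A).re) (hmu_decomp L hL 3)
  simp only [map_add, LinearMap.map_smul, map_sum, smul_eq_mul, h1, mul_one, Complex.add_re,
    Complex.re_ofReal_mul, Complex.re_sum, hE, Complex.ofReal_re] at hdec
  have hsumQ : 0 ≤ ∑ z : TorusSite 3 L, ∑ i : Fin 3,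
      (ω ((E z - E (z + Pi.single i 1))ᴴ * (E z - E (z + Pi.single i 1)))).re :=
    Finset.sum_nonneg fun z _ => Finset.sum_nonneg fun i _ => hQ z i
  nlinarith [hdec, hsumQ]

/-- **Kernel of the certificate at `μ = 3`**: every ground vector of `H_{L,3}` is killed by every
bond square, `(S⁺_x − S⁺_{x+eᵢ}) v = 0`. [folklore] -/
theorem bond_mulVec_eq_zero_of_mem (hL : 3 ≤ L) {v : TensorIndex (TorusSite 3 L) 2 → ℂ}
    (hv : v ∈ (Hmu L 3).groundSpace) (x : TorusSite 3 L) (i : Fin 3) :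
    (E x - E (x + Pi.single i 1)) *ᵥ v = 0 := by
  rw [mem_groundSpace_iff, groundEnergy_hmu_three L hL, hmu_decomp L hL 3, add_mulVec, add_mulVec,
    smul_mulVec, smul_mulVec, smul_mulVec, one_mulVec,
    show ((3 : ℝ) - 3 : ℝ) = 0 by norm_num, Complex.ofReal_zero, zero_smul, add_zero] at hv
  have h2 : ((1 / 2 : ℝ) : ℂ) • ((∑ z : TorusSite 3 L, ∑ j : Fin 3,
      (E z - E (z + Pi.single j 1))ᴴ * (E z - E (z + Pi.single j 1))) *ᵥ v) = 0 := by
    have := congrArg (fun w => w - (((-(3 * Fintype.card (TorusSite 3 L) / 2) : ℝ) : ℂ)) • v) hv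
    simpa using this
  have hhalf : ((1 / 2 : ℝ) : ℂ) ≠ 0 := by norm_num
  have hQv := (smul_eq_zero.mp h2).resolve_left hhalf
  have hquad : ∑ z : TorusSite 3 L, ∑ j : Fin 3,
      star ((E z - E (z + Pi.single j 1)) *ᵥ v) ⬝ᵥ ((E z - E (z + Pi.single j 1)) *ᵥ v) = 0 := by
    have := congrArg (fun w => star v ⬝ᵥ w) hQv
    simpa only [Matrix.sum_mulVec, dotProduct_sum, star_dotProduct_conjTranspose_mul_mulVec,
      dotProduct_zero] using this
  have hnn : ∀ (z : TorusSite 3 L) (j : Fin 3),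
      0 ≤ star ((E z - E (z + Pi.single j 1)) *ᵥ v) ⬝ᵥ ((E z - E (z + Pi.single j 1)) *ᵥ v) :=
    fun z j => dotProduct_star_self_nonneg _
  have hz := (Finset.sum_eq_zero_iff_of_nonneg (fun z _ => Finset.sum_nonneg fun j _ => hnn z j)).mp
    hquad x (Finset.mem_univ x)
  have hzi := (Finset.sum_eq_zero_iff_of_nonneg (fun j _ => hnn x j)).mp hz i (Finset.mem_univ i)
  exact dotProduct_star_self_eq_zero.mp hzi

/-- The coordinate "taxicab potential" `Σ_j val((b − a)_j)` used to walk `a` to `b` along bonds.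
[folklore] -/
def tdist (a b : TorusSite 3 L) : ℕ := ∑ j : Fin 3, ((b - a) j).val

omit [NeZero L] in
/-- `tdist a b = 0 → a = b`. [folklore] -/
theorem eq_of_tdist_eq_zero {a b : TorusSite 3 L} (h : tdist L a b = 0) : a = b := by
  unfold tdist at h
  have hj : ∀ j : Fin 3, ((b - a) j).val = 0 := fun j =>
    (Finset.sum_eq_zero_iff.mp h) j (Finset.mem_univ j)
  have : b - a = 0 := funext fun j => (ZMod.val_eq_zero _).mp (hj j)
  exact (sub_eq_zero.mp this).symm

/-- One step along `eᵢ` lowers the potential by one (`L ≥ 3`). [folklore] -/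
theorem tdist_step (hL : 3 ≤ L) {a b : TorusSite 3 L} {i : Fin 3} (hi : ((b - a) i).val ≠ 0) :
    tdist L (a + Pi.single i 1) b + 1 = tdist L a b := by
  haveI : Fact (1 < L) := ⟨by omega⟩
  unfold tdist
  have key : ∀ j : Fin 3, ((b - (a + Pi.single i 1) : TorusSite 3 L) j).val =
      if j = i then ((b - a) i).val - 1 else ((b - a) j).val := by
    intro j
    by_cases hji : j = i
    · subst hji
      rw [if_pos rfl, Pi.sub_apply, Pi.add_apply, Pi.single_eq_same, ← sub_sub,
        ZMod.val_sub (by rw [ZMod.val_one]; exact Nat.one_le_iff_ne_zero.mpr hi), ZMod.val_one]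
      rfl
    · rw [if_neg hji, Pi.sub_apply, Pi.add_apply, Pi.single_eq_of_ne hji, add_zero]
      rfl
  simp only [key]
  rw [← Finset.add_sum_erase _ _ (Finset.mem_univ i),
    ← Finset.add_sum_erase Finset.univ (fun j => ((b - a) j).val) (Finset.mem_univ i), if_pos rfl,
    Finset.sum_congr rfl fun j hj => if_neg (Finset.ne_of_mem_erase hj)]
  have h1 : 1 ≤ ((b - a) i).val := Nat.one_le_iff_ne_zero.mpr hi
  omega

/-- **Propagation along bonds**: if `S⁺_x v = S⁺_{x+eᵢ} v` for all directed bonds then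
`S⁺_a v = S⁺_b v` for ALL sites (the torus is connected). [folklore] -/
theorem E_mulVec_eq_of_bonds (hL : 3 ≤ L) {v : TensorIndex (TorusSite 3 L) 2 → ℂ}
    (hC : ∀ (x : TorusSite 3 L) (i : Fin 3), E x *ᵥ v = E (x + Pi.single i 1) *ᵥ v)
    (a b : TorusSite 3 L) : E a *ᵥ v = E b *ᵥ v := by
  suffices h : ∀ (K : ℕ) (a : TorusSite 3 L), tdist L a b = K → E a *ᵥ v = E b *ᵥ v from
    h _ a rfl
  intro K
  induction K with
  | zero => intro a h; rw [eq_of_tdist_eq_zero L h]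
  | succ K ih =>
    intro a h
    obtain ⟨i, hi⟩ : ∃ i : Fin 3, ((b - a) i).val ≠ 0 := by
      by_contra hcon
      push Not at hcon
      have : tdist L a b = 0 := Finset.sum_eq_zero fun j _ => hcon j
      omega
    rw [hC a i]
    apply ih
    have := tdist_step L hL hi
    omega

/-- **Structure of ground vectors at `μ = 3`**: `S⁺_x v = v(x↓) · |⇑⟩` for every site `x`, with
`x↓` the configuration with the single down spin at `x`. [folklore] -/
theorem E_mulVec_eq_smul_upVec (hL : 3 ≤ L) {v : TensorIndex (TorusSite 3 L) 2 → ℂ}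
    (hv : v ∈ (Hmu L 3).groundSpace) (x : TorusSite 3 L) :
    E x *ᵥ v = v (Function.update (fun _ => 0) x 1) • upVec := by
  have hC : ∀ (y : TorusSite 3 L) (i : Fin 3), E y *ᵥ v = E (y + Pi.single i 1) *ᵥ v := by
    intro y i
    have := bond_mulVec_eq_zero_of_mem L hL hv y i
    rwa [sub_mulVec, sub_eq_zero] at this
  have hall : ∀ y : TorusSite 3 L, E y *ᵥ v = E x *ᵥ v := fun y =>
    E_mulVec_eq_of_bonds L hL hC y x
  have hker : ∀ y : TorusSite 3 L, E y *ᵥ (E x *ᵥ v) = 0 := by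
    intro y
    by_cases hyx : y = x
    · subst hyx
      rw [mulVec_mulVec, E_mul_E, zero_mulVec]
    · rw [mulVec_mulVec, E, E, onSite_mul_onSite_comm hyx, ← E, ← E, ← mulVec_mulVec, hall y,
        mulVec_mulVec, E_mul_E, zero_mulVec]
  have key := eq_smul_upVec_of_forall_E_mulVec_eq_zero (E x *ᵥ v) hker
  rw [key, E_mulVec_apply, if_pos rfl]

/-- All single-down amplitudes of a ground vector agree. [folklore] -/
theorem apply_single_eq (hL : 3 ≤ L) {v : TensorIndex (TorusSite 3 L) 2 → ℂ}
    (hv : v ∈ (Hmu L 3).groundSpace) (x y : TorusSite 3 L) :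
    v (Function.update (fun _ => 0) x 1) = v (Function.update (fun _ => 0) y 1) := by
  have hC : ∀ (z : TorusSite 3 L) (i : Fin 3), E z *ᵥ v = E (z + Pi.single i 1) *ᵥ v := by
    intro z i
    have := bond_mulVec_eq_zero_of_mem L hL hv z i
    rwa [sub_mulVec, sub_eq_zero] at this
  have h := E_mulVec_eq_of_bonds L hL hC x y
  rw [E_mulVec_eq_smul_upVec L hL hv x, E_mulVec_eq_smul_upVec L hL hv y] at h
  have := congrFun h (fun _ => 0)
  simpa [upVec] using this

/-- **The total raising operator on a ground vector**: `S⁺_tot v = |Λ| v(x₀↓) · |⇑⟩`. [folklore] -/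
theorem sumE_mulVec_eq (hL : 3 ≤ L) {v : TensorIndex (TorusSite 3 L) 2 → ℂ}
    (hv : v ∈ (Hmu L 3).groundSpace) (x₀ : TorusSite 3 L) :
    (∑ x : TorusSite 3 L, E x) *ᵥ v =
      ((Fintype.card (TorusSite 3 L) : ℂ) * v (Function.update (fun _ => 0) x₀ 1)) • upVec := by
  rw [Matrix.sum_mulVec, Finset.sum_congr rfl fun x _ => E_mulVec_eq_smul_upVec L hL hv x,
    Finset.sum_congr rfl fun x _ => by rw [apply_single_eq L hL hv x x₀], Finset.sum_const,
    Finset.card_univ, ← Nat.cast_smul_eq_nsmul ℂ, smul_smul]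

/-- `|Λ| |v(x₀↓)|² ≤ ‖v‖²` (the single-down configurations are distinct). [folklore] -/
theorem card_mul_normSq_single_le (hL : 3 ≤ L) {v : TensorIndex (TorusSite 3 L) 2 → ℂ}
    (hv : v ∈ (Hmu L 3).groundSpace) (x₀ : TorusSite 3 L) :
    (Fintype.card (TorusSite 3 L) : ℝ) * Complex.normSq (v (Function.update (fun _ => 0) x₀ 1)) ≤
      (star v ⬝ᵥ v).re := by
  set single : TorusSite 3 L → TensorIndex (TorusSite 3 L) 2 := fun x => Function.update (fun _ => 0) x 1
    with hsingle
  have hinj : Function.Injective single := by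
    intro x y h
    by_contra hxy
    have := congrFun h x
    simp [hsingle, hxy] at this
  have hre : (star v ⬝ᵥ v).re = ∑ τ, Complex.normSq (v τ) := by
    simp only [dotProduct, Pi.star_apply, Complex.re_sum, Complex.star_def]
    refine Finset.sum_congr rfl fun τ _ => ?_
    rw [mul_comm, Complex.mul_conj, Complex.ofReal_re]
  rw [hre]
  calc (Fintype.card (TorusSite 3 L) : ℝ) * Complex.normSq (v (single x₀))
      = ∑ x : TorusSite 3 L, Complex.normSq (v (single x)) := by
        rw [Finset.sum_congr rfl fun x _ => by rw [apply_single_eq L hL hv x x₀], Finset.sum_const,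
          Finset.card_univ, nsmul_eq_mul]
    _ = ∑ τ ∈ Finset.univ.image single, Complex.normSq (v τ) := by
        rw [Finset.sum_image fun x _ y _ h => hinj h]
    _ ≤ ∑ τ, Complex.normSq (v τ) :=
        Finset.sum_le_sum_of_subset_of_nonneg (Finset.subset_univ _)
          fun τ _ _ => Complex.normSq_nonneg _

/-- **Quadratic-form bound on the ground space at `μ = 3`**:
`Re ⟨v, Σ_{x,y}(S¹_xS¹_y + S²_xS²_y) v⟩ ≤ (3|Λ|/2) ‖v‖²`. [folklore] -/
theorem re_sum_hop_quad_le (hL : 3 ≤ L) {v : TensorIndex (TorusSite 3 L) 2 → ℂ}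
    (hv : v ∈ (Hmu L 3).groundSpace) :
    (star v ⬝ᵥ (∑ x : TorusSite 3 L, ∑ y : TorusSite 3 L, hop x y) *ᵥ v).re ≤
      3 * (Fintype.card (TorusSite 3 L) : ℝ) / 2 * (star v ⬝ᵥ v).re := by
  obtain ⟨x₀⟩ : Nonempty (TorusSite 3 L) := inferInstance
  rw [sum_hop_eq, add_mulVec, dotProduct_add, Complex.add_re,
    star_dotProduct_conjTranspose_mul_mulVec, sumE_mulVec_eq L hL hv x₀]
  have h1 : (star ((((Fintype.card (TorusSite 3 L) : ℂ) * v (Function.update (fun _ => 0) x₀ 1)) •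
      (upVec : TensorIndex (TorusSite 3 L) 2 → ℂ))) ⬝ᵥ
      ((((Fintype.card (TorusSite 3 L) : ℂ) * v (Function.update (fun _ => 0) x₀ 1)) • upVec))).re =
      (Fintype.card (TorusSite 3 L) : ℝ) ^ 2 * Complex.normSq (v (Function.update (fun _ => 0) x₀ 1)) := by
    rw [star_smul, smul_dotProduct, dotProduct_smul, star_upVec_dotProduct_upVec, smul_eq_mul,
      smul_eq_mul, mul_one, Complex.star_def, mul_comm, Complex.mul_conj, Complex.ofReal_re,
      Complex.normSq_mul, Complex.normSq_natCast]
    ring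
  rw [h1]
  have h2 := card_mul_normSq_single_le L hL hv x₀
  have h3 := re_totalSpin_two_quad_le v
  have hcard : (0 : ℝ) ≤ Fintype.card (TorusSite 3 L) := Nat.cast_nonneg _
  nlinarith

/-- **`Re ω_{L,3}(Σ_{x,y}(S¹_xS¹_y + S²_xS²_y)) ≤ 3|Λ|/2`** (`L ≥ 3`): the tracial ground state at the
saturation field (ground space `span{|⇑⟩, |q=0 magnon⟩}`) has order parameter `O(|Λ|)`, not
`O(|Λ|²)`. [folklore] -/
theorem re_gsf_sum_hop_le (hL : 3 ≤ L) :
    ((Hmu L 3).groundStateFunctional (∑ x : TorusSite 3 L, ∑ y : TorusSite 3 L, hop x y)).re ≤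
      3 * (Fintype.card (TorusSite 3 L) : ℝ) / 2 := by
  have hH : (Hmu L 3).IsHermitian := Hmu_isHermitian L 3
  have key := re_gsf_nonneg_of_groundSpace (A := Hmu L 3)
    (T := ((3 * (Fintype.card (TorusSite 3 L) : ℝ) / 2 : ℝ) : ℂ) • 1 -
      ∑ x : TorusSite 3 L, ∑ y : TorusSite 3 L, hop x y) (fun v hv => by
    rw [sub_mulVec, smul_mulVec, one_mulVec, dotProduct_sub, dotProduct_smul, Complex.sub_re,
      smul_eq_mul, Complex.re_ofReal_mul]
    have := re_sum_hop_quad_le L hL hv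
    linarith)
  rw [map_sub, LinearMap.map_smul, groundStateFunctional_one hH, Complex.sub_re, smul_eq_mul,
    mul_one, Complex.ofReal_re] at key
  linarith

/-- **No ODLRO at the saturation field itself**: `¬ LROAt 3`. With `not_lroAt_of_three_lt`,
`lroAt_neg_iff` and `orderParam_nonneg` this pins the closed complement `|μ| ≥ 3` exactly: the
`k`-th liminf term at `μ = 3` lies in `[0, 3/(2(2k)³)]`. [folklore] -/
theorem not_lroAt_three : ¬ LROAt 3 := by
  intro h
  unfold LROAt at h
  obtain ⟨f, hf, hlo, hhi⟩ : ∃ f : ℕ → ℝ, 0 < Filter.liminf f Filter.atTop ∧ (∀ k, 0 ≤ f k) ∧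
      ∀ k : ℕ, 2 ≤ k → f k ≤ 3 / (2 * ((2 * k : ℕ) : ℝ) ^ 3) := by
    refine ⟨_, h, fun k => orderParam_nonneg 3 k, fun k hk => ?_⟩
    have hL0 : 2 * k ≠ 0 := by omega
    haveI : NeZero (2 * k) := ⟨hL0⟩
    have hL3 : 3 ≤ 2 * k := by omega
    have hcard : Fintype.card (TorusSite 3 (2 * k)) = (2 * k) ^ 3 := by
      simp [ZMod.card, Fintype.card_fin]
    simp only [torusPullback_apply, dif_neg hL0]
    rw [sum_sq_halfOpenBox_comp_torusProj (fun s t : TorusSite 3 (2 * k) =>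
      (∑ α : Fin 2, (Hmu (2 * k) 3).groundStateFunctional
        (siteSpin 1 s (Fin.castSucc α) * siteSpin 1 t (Fin.castSucc α))).re)]
    have hsum : (∑ s : TorusSite 3 (2 * k), ∑ t : TorusSite 3 (2 * k),
        (∑ α : Fin 2, (Hmu (2 * k) 3).groundStateFunctional
          (siteSpin 1 s (Fin.castSucc α) * siteSpin 1 t (Fin.castSucc α))).re) =
        ((Hmu (2 * k) 3).groundStateFunctional
          (∑ s : TorusSite 3 (2 * k), ∑ t : TorusSite 3 (2 * k), hop s t)).re := by
      simp only [map_sum, Complex.re_sum]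
      refine Finset.sum_congr rfl fun s _ => Finset.sum_congr rfl fun t _ => ?_
      rw [Fin.sum_univ_two, hop, map_add, Complex.add_re]
      rfl
    rw [hsum, card_halfOpenBox]
    have hb := re_gsf_sum_hop_le (2 * k) hL3
    rw [hcard] at hb
    push_cast at hb ⊢
    have hk : (0 : ℝ) < k := by exact_mod_cast (show 0 < k by omega)
    have hX : (0 : ℝ) < (2 * (k : ℝ)) ^ 3 := by positivity
    rw [div_le_div_iff₀ (by positivity) (by positivity)]
    nlinarith [hb, hX]
  have hlim : Filter.Tendsto (fun k : ℕ => 3 / (2 * ((2 * k : ℕ) : ℝ) ^ 3)) Filter.atTop (nhds 0) := by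
    have : Filter.Tendsto (fun k : ℕ => 2 * ((2 * k : ℕ) : ℝ) ^ 3) Filter.atTop Filter.atTop := by
      refine Filter.Tendsto.const_mul_atTop (by norm_num) ?_
      refine (Filter.tendsto_pow_atTop (by norm_num)).comp ?_
      exact tendsto_natCast_atTop_atTop.comp (Filter.tendsto_id.const_mul_atTop' (by norm_num))
    exact tendsto_const_nhds.div_atTop this
  have hlim' : Filter.Tendsto f Filter.atTop (nhds 0) :=
    tendsto_of_tendsto_of_tendsto_of_le_of_le' tendsto_const_nhds hlim
      (Filter.Eventually.of_forall hlo) ((Filter.eventually_ge_atTop 2).mono fun k hk => hhi k hk)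
  rw [hlim'.liminf_eq] at hf
  exact lt_irrefl 0 hf

/-- Likewise `¬ LROAt (−3)` (flip symmetry). [folklore] -/
theorem not_lroAt_neg_three : ¬ LROAt (-3) := by
  rw [lroAt_neg_iff]; exact not_lroAt_three

/-- **The ODLRO set is contained in the OPEN interval `(−3, 3)`**: `LROAt μ → |μ| < 3`.
[folklore] -/
theorem abs_lt_three_of_lroAt {μ : ℝ} (h : LROAt μ) : |μ| < 3 := by
  by_contra hcon
  push Not at hcon
  rcases hcon.lt_or_eq with hlt | heq
  · rcases lt_abs.mp hlt with h1 | h1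
    · exact not_lroAt_of_three_lt h1 h
    · exact not_lroAt_of_lt_neg_three (by linarith) h
  · rcases abs_eq (by norm_num : (0 : ℝ) ≤ 3) |>.mp heq.symm with rfl | rfl
    · exact not_lroAt_three h
    · exact not_lroAt_neg_three h

end Boundary

/-! ### Off half filling is FORCED: at `μ ≠ 0` no ground state of `H_{L,μ}` is half filled (large even `L`) -/

section OffHalf

variable {Λ : Type*} [Fintype Λ] [DecidableEq Λ]

/-- `a_x Ŝ^b_tot = Ŝ^b_tot a_x + ([a, Ŝ^b])_x` for any single-site matrix `a`
(cf. `siteSpin_mul_totalSpin`). [folklore] -/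
theorem onSite_mul_totalSpin (x : Λ) (a : Matrix (Fin 2) (Fin 2) ℂ) (b : Fin 3) :
    (onSite x a * totalSpin 1 b : Op Λ 2) = totalSpin 1 b * onSite x a + onSite x ⁅a, spinVec 1 b⁆ := by
  have key : ∀ z : Λ, (onSite x a * siteSpin 1 z b : Op Λ 2) =
      siteSpin 1 z b * onSite x a + if z = x then onSite x ⁅a, spinVec 1 b⁆ else 0 := by
    intro z
    by_cases hz : z = x
    · subst hz
      rw [if_pos rfl]
      simp only [siteSpin]
      rw [onSite_mul, onSite_mul, ← onSite_add', Ring.lie_def]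
      congr 1
      abel
    · rw [if_neg hz, add_zero]
      exact onSite_mul_onSite_comm (Ne.symm hz) _ _
  calc (onSite x a * totalSpin 1 b : Op Λ 2)
      = ∑ z, onSite x a * siteSpin 1 z b := by rw [totalSpin, Finset.mul_sum]
    _ = ∑ z, (siteSpin 1 z b * onSite x a +
          if z = x then onSite x ⁅a, spinVec 1 b⁆ else 0) :=
        Finset.sum_congr rfl fun z _ => key z
    _ = totalSpin 1 b * onSite x a + onSite x ⁅a, spinVec 1 b⁆ := by
        rw [Finset.sum_add_distrib, Finset.sum_ite_eq', if_pos (Finset.mem_univ x), totalSpin,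
          Finset.sum_mul]

/-- `[e, S³] = −e` (raising lowers `S³`-weight bookkeeping: `S³ e = e (S³ + 1)`). [folklore] -/
theorem lie_raise_spinVec_two : ⁅raise, spinVec 1 2⁆ = -raise := by
  have hZ : spinVec 1 2 = !![(1 / 2 : ℂ), 0; 0, -(1 / 2)] := by
    rw [spinVec_two]
    ext i j
    fin_cases i <;> fin_cases j <;> norm_num [SpinOperators.spinZ, Matrix.diagonal_apply]
  rw [Ring.lie_def, hZ]
  ext i j
  fin_cases i <;> fin_cases j <;> norm_num [raise, Matrix.mul_apply, Fin.sum_univ_two]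

/-- `S³_tot S⁺_x = S⁺_x (S³_tot + 1)`. [folklore] -/
theorem totalSpin_two_mul_E (x : Λ) :
    (totalSpin 1 2 : Op Λ 2) * E x = E x * totalSpin 1 2 + E x := by
  have h := onSite_mul_totalSpin x raise 2
  rw [lie_raise_spinVec_two, onSite_neg'] at h
  change E x * totalSpin 1 2 = totalSpin 1 2 * E x + -E x at h
  rw [h]
  abel

/-- `S³_tot S⁺_tot = S⁺_tot (S³_tot + 1)`. [folklore] -/
theorem totalSpin_two_mul_sumE :
    (totalSpin 1 2 : Op Λ 2) * ∑ x : Λ, E x = (∑ x : Λ, E x) * totalSpin 1 2 + ∑ x : Λ, E x := by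
  rw [Finset.mul_sum, Finset.sum_mul, ← Finset.sum_add_distrib]
  exact Finset.sum_congr rfl fun x _ => totalSpin_two_mul_E x

/-- `[S³_x, S³_tot] = 0`. [folklore] -/
theorem commute_siteSpin_two_totalSpin_two (x : Λ) :
    Commute (siteSpin 1 x 2) (totalSpin 1 2 : Op Λ 2) := by
  have h := siteSpin_mul_totalSpin_sub 1 x (2 : Fin 3) 2
  rw [Ring.lie_def, sub_self, onSite_zero] at h
  exact sub_eq_zero.mp h

/-- **`U(1)` invariance of the XY bond**: `[S¹_xS¹_y + S²_xS²_y, S³_tot] = 0`. [folklore] -/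
theorem commute_hop_totalSpin_two (x y : Λ) : Commute (hop x y) (totalSpin 1 2 : Op Λ 2) := by
  have h3 := commute_sum_siteSpin_mul_siteSpin_totalSpin 1 x y 2
  have heq : hop x y = (∑ α : Fin 3, siteSpin 1 x α * siteSpin 1 y α) -
      siteSpin 1 x 2 * siteSpin 1 y 2 := by
    rw [Fin.sum_univ_three, hop]
    abel
  rw [heq]
  exact h3.sub_left ((commute_siteSpin_two_totalSpin_two x).mul_left
    (commute_siteSpin_two_totalSpin_two y))

/-- Entries of `P↓_x w`: diagonal, `[σ_x = ↓] w(σ)`. [folklore] -/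
theorem Pd_mulVec_apply (x : Λ) (w : TensorIndex Λ 2 → ℂ) (σ : TensorIndex Λ 2) :
    (Pd x *ᵥ w) σ = if σ x = 1 then w σ else 0 := by
  rw [Pd, LiebMattis.onSite_mulVec_apply, Fin.sum_univ_two]
  by_cases hσ : σ x = 1
  · rw [if_pos hσ, hσ]
    have h10 : pDown 1 0 = 0 := by simp [pDown]
    have h11 : pDown 1 1 = 1 := by simp [pDown]
    rw [h10, h11, zero_mul, zero_add, one_mul, ← hσ, Function.update_eq_self]
  · have h0 : σ x = 0 := by
      rcases Fin.exists_fin_two.mp ⟨σ x, rfl⟩ with h | h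
      · exact h
      · exact absurd h hσ
    rw [if_neg hσ, h0]
    have h00 : pDown 0 0 = 0 := by simp [pDown]
    have h01 : pDown 0 1 = 0 := by simp [pDown]
    rw [h00, h01, zero_mul, zero_mul, add_zero]

/-- The number of down spins of a configuration. [folklore] -/
def downCount (σ : TensorIndex Λ 2) : ℕ := (Finset.univ.filter fun x : Λ => σ x = 1).card

/-- `N↓ |σ⟩ = (#↓ σ) |σ⟩`. [folklore] -/
theorem sum_Pd_mulVec_single (σ : TensorIndex Λ 2) :
    (∑ x : Λ, Pd x) *ᵥ (Pi.single σ (1 : ℂ)) = (downCount σ : ℂ) • Pi.single σ 1 := by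
  rw [Matrix.sum_mulVec]
  have h : ∀ x : Λ, Pd x *ᵥ (Pi.single σ (1 : ℂ)) = if σ x = 1 then Pi.single σ 1 else 0 := by
    intro x
    ext τ
    rw [Pd_mulVec_apply]
    by_cases hτ : τ = σ
    · subst hτ
      split_ifs <;> simp
    · have h0 : (Pi.single σ (1 : ℂ) : TensorIndex Λ 2 → ℂ) τ = 0 := by
        simp [hτ]
      rw [h0]
      split_ifs <;> first | rfl | rw [h0]
  rw [Finset.sum_congr rfl fun x _ => h x, Finset.sum_ite, Finset.sum_const_zero, add_zero,
    Finset.sum_const, ← Nat.cast_smul_eq_nsmul ℂ, downCount]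

/-- **Basis configurations are `S³_tot`-eigenvectors**: `S³_tot |σ⟩ = (|Λ|/2 − #↓σ)|σ⟩`.
[folklore] -/
theorem totalSpin_two_mulVec_single (σ : TensorIndex Λ 2) :
    (totalSpin 1 2 : Op Λ 2) *ᵥ Pi.single σ 1 =
      ((Fintype.card Λ : ℂ) / 2 - (downCount σ : ℂ)) • Pi.single σ 1 := by
  rw [totalSpin_two_eq, sub_mulVec, smul_mulVec, one_mulVec, sum_Pd_mulVec_single, sub_smul]

/-- **The trace behind the tracial ground state**: `tr(P₀T) = Σ_σ ⟨P₀e_σ, T P₀e_σ⟩`. [folklore] -/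
theorem trace_groundProj_mul_eq_sum {m : Type*} [Fintype m] [DecidableEq m] (A T : Matrix m m ℂ) :
    (A.groundProj * T).trace = ∑ σ, star (A.groundProj.col σ) ⬝ᵥ T *ᵥ (A.groundProj.col σ) := by
  set P := A.groundProj with hPdef
  have hP : Pᴴ = P := (groundProj_isHermitian A).eq
  have hPP : P * P = P := groundProj_mul_self A
  have h1 : (P * T).trace = (Pᴴ * T * P).trace := by
    rw [hP]
    calc (P * T).trace = (T * P).trace := trace_mul_comm _ _
      _ = (T * (P * P)).trace := by rw [hPP]
      _ = (T * P * P).trace := by rw [Matrix.mul_assoc]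
      _ = (P * (T * P)).trace := trace_mul_comm _ _
      _ = (P * T * P).trace := by rw [Matrix.mul_assoc]
  rw [h1]
  simp only [Matrix.trace, Matrix.diag, Matrix.mul_apply, dotProduct, mulVec, Matrix.col_apply,
    Pi.star_apply, conjTranspose_apply, Finset.sum_mul, Finset.mul_sum]
  refine Finset.sum_congr rfl fun σ _ => ?_
  rw [Finset.sum_comm]
  refine Finset.sum_congr rfl fun a _ => Finset.sum_congr rfl fun b _ => ?_
  ring

/-- The columns of `P₀` are ground vectors. [folklore] -/
theorem groundProj_col_mem {m : Type*} [Fintype m] [DecidableEq m] (A : Matrix m m ℂ) (σ : m) :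
    A.groundProj.col σ ∈ A.groundSpace := by
  rw [← mulVec_single_one]
  exact groundProj_mulVec_mem A _

/-- `star v ⬝ᵥ v` is the real number `Σ|v_i|²`. [folklore] -/
theorem star_dotProduct_self_eq_ofReal {m : Type*} [Fintype m] (v : m → ℂ) :
    star v ⬝ᵥ v = (((star v ⬝ᵥ v).re : ℝ) : ℂ) := by
  obtain ⟨-, him⟩ := Complex.nonneg_iff.mp (dotProduct_star_self_nonneg v)
  exact Complex.ext (by simp) (by simp [← him])

/-- **Pigeonhole in the ground space**: if `c ≤ Re ω_A(T)` then some nonzero column `ψ = P₀e_σ`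
(a ground vector) has `c‖ψ‖² ≤ Re⟨ψ, Tψ⟩`. [folklore] -/
theorem exists_col_quad_ge {m : Type*} [Fintype m] [DecidableEq m] [Nonempty m]
    {A : Matrix m m ℂ} (hA : A.IsHermitian) (T : Matrix m m ℂ) (c : ℝ)
    (h : c ≤ (A.groundStateFunctional T).re) :
    ∃ σ, A.groundProj.col σ ≠ 0 ∧ c * (star (A.groundProj.col σ) ⬝ᵥ A.groundProj.col σ).re ≤
      (star (A.groundProj.col σ) ⬝ᵥ T *ᵥ (A.groundProj.col σ)).re := by
  by_contra hcon
  push Not at hcon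
  set P := A.groundProj with hPdef
  have htrT := trace_groundProj_mul_eq_sum A T
  have htr1 : P.trace = ∑ σ, star (P.col σ) ⬝ᵥ (P.col σ) := by
    have := trace_groundProj_mul_eq_sum A 1
    rw [mul_one] at this
    simpa only [one_mulVec] using this
  have hnn : ∀ σ, 0 ≤ (star (P.col σ) ⬝ᵥ (P.col σ)).re := fun σ =>
    (Complex.nonneg_iff.mp (dotProduct_star_self_nonneg _)).1
  have hle : ∀ σ, (star (P.col σ) ⬝ᵥ T *ᵥ P.col σ).re ≤ c * (star (P.col σ) ⬝ᵥ P.col σ).re := by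
    intro σ
    by_cases h0 : P.col σ = 0
    · simp [h0]
    · exact (hcon σ h0).le
  obtain ⟨σ₀, hσ₀⟩ : ∃ σ, P.col σ ≠ 0 := by
    by_contra hall
    push Not at hall
    have : P.trace = 0 := by
      rw [htr1]
      exact Finset.sum_eq_zero fun σ _ => by simp [hall σ]
    exact (trace_groundProj_ne_zero hA) this
  have hpos₀ : 0 < (star (P.col σ₀) ⬝ᵥ (P.col σ₀)).re := by
    have hne : star (P.col σ₀) ⬝ᵥ (P.col σ₀) ≠ 0 := fun h0 =>
      hσ₀ (dotProduct_star_self_eq_zero.mp h0)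
    have hre := star_dotProduct_self_eq_ofReal (P.col σ₀)
    rcases (hnn σ₀).lt_or_eq with hlt | heq
    · exact hlt
    · exfalso; apply hne; rw [hre, ← heq]; simp
  have hS : 0 < ∑ σ, (star (P.col σ) ⬝ᵥ (P.col σ)).re :=
    Finset.sum_pos' (fun σ _ => hnn σ) ⟨σ₀, Finset.mem_univ _, hpos₀⟩
  have hlt : (∑ σ, (star (P.col σ) ⬝ᵥ T *ᵥ P.col σ).re) <
      ∑ σ, c * (star (P.col σ) ⬝ᵥ P.col σ).re :=
    Finset.sum_lt_sum (fun σ _ => hle σ) ⟨σ₀, Finset.mem_univ _, hcon σ₀ hσ₀⟩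
  rw [← Finset.mul_sum] at hlt
  have hω : (A.groundStateFunctional T).re =
      (∑ σ, (star (P.col σ) ⬝ᵥ T *ᵥ P.col σ).re) / ∑ σ, (star (P.col σ) ⬝ᵥ (P.col σ)).re := by
    rw [groundStateFunctional_apply, ← hPdef, htrT, htr1]
    have hreal : (∑ σ, star (P.col σ) ⬝ᵥ (P.col σ)) =
        (((∑ σ, (star (P.col σ) ⬝ᵥ (P.col σ)).re) : ℝ) : ℂ) := by
      rw [Complex.ofReal_sum]
      exact Finset.sum_congr rfl fun σ _ => star_dotProduct_self_eq_ofReal _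
    rw [hreal, ← Complex.ofReal_inv, Complex.re_ofReal_mul, Complex.re_sum, inv_mul_eq_div]
  rw [hω, le_div_iff₀ hS] at h
  linarith

/-! #### Two-site algebra: `[hop, S⁺]` and the double commutator `[S⁻_tot, [H₀, S⁺_tot]]` -/

/-- `e eᴴ = 1 − P↓` (`= P↑`). [folklore] -/
theorem E_mul_conjTranspose (x : Λ) : E x * (E x)ᴴ = 1 - Pd x := by
  rw [E_conjTranspose, E, onSite_mul, Pd, ← onSite_one', ← onSite_sub']
  congr 1
  ext i j
  fin_cases i <;> fin_cases j <;> simp [raise, pDown, Matrix.mul_apply, conjTranspose_apply]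

/-- `e P↓ = e`. [folklore] -/
theorem E_mul_Pd (x : Λ) : E x * Pd x = E x := by
  rw [E, Pd, onSite_mul]
  congr 1
  ext i j
  fin_cases i <;> fin_cases j <;> simp [raise, pDown, Matrix.mul_apply]

/-- `P↓ e = 0`. [folklore] -/
theorem Pd_mul_E (x : Λ) : Pd x * E x = 0 := by
  rw [E, Pd, onSite_mul]
  have : pDown * raise = 0 := by
    ext i j; fin_cases i <;> fin_cases j <;> simp [raise, pDown, Matrix.mul_apply]
  rw [this]
  ext σ τ
  simp [onSite_apply]

/-- `eᴴ P↓ = 0`. [folklore] -/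
theorem E_conjTranspose_mul_Pd (x : Λ) : (E x)ᴴ * Pd x = 0 := by
  have h := congrArg conjTranspose (Pd_mul_E x)
  rw [conjTranspose_mul, conjTranspose_zero] at h
  have hP : (Pd x)ᴴ = Pd x := by
    rw [← E_conjTranspose_mul_E, conjTranspose_mul, conjTranspose_conjTranspose]
  rwa [hP] at h

/-- `P↓ eᴴ = eᴴ`. [folklore] -/
theorem Pd_mul_E_conjTranspose (x : Λ) : Pd x * (E x)ᴴ = (E x)ᴴ := by
  have h := congrArg conjTranspose (E_mul_Pd x)
  rw [conjTranspose_mul] at h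
  have hP : (Pd x)ᴴ = Pd x := by
    rw [← E_conjTranspose_mul_E, conjTranspose_mul, conjTranspose_conjTranspose]
  rwa [hP] at h

/-- The bond operator is symmetric in its sites. [folklore] -/
theorem hop_comm (x y : Λ) : hop x y = hop y x := by
  by_cases hxy : x = y
  · subst hxy; rfl
  · rw [hop, hop, (siteSpin_commute_of_ne_holds 1 hxy 0 0).eq,
      (siteSpin_commute_of_ne_holds 1 hxy 1 1).eq]

/-- **`[hop_{xy}, S⁺_x] = (P↓_x − ½) S⁺_y`** (`x ≠ y`). [folklore] -/
theorem hop_mul_E_sub (x y : Λ) (hxy : x ≠ y) :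
    hop x y * E x - E x * hop x y = Pd x * E y - (1 / 2 : ℂ) • E y := by
  have hc1 : (E y)ᴴ * E x = E x * (E y)ᴴ := by
    rw [E_conjTranspose, E, onSite_mul_onSite_comm hxy.symm]
  have hc2 : E y * E x = E x * E y := by rw [E, E, onSite_mul_onSite_comm hxy.symm]
  have m1 : E x * (E y)ᴴ * E x = 0 := by
    rw [Matrix.mul_assoc, hc1, ← Matrix.mul_assoc, E_mul_E, Matrix.zero_mul]
  have m2 : (E x)ᴴ * E y * E x = Pd x * E y := by
    rw [Matrix.mul_assoc, hc2, ← Matrix.mul_assoc, E_conjTranspose_mul_E]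
  have m3 : E x * (E x * (E y)ᴴ) = 0 := by
    rw [← Matrix.mul_assoc, E_mul_E, Matrix.zero_mul]
  have m4 : E x * ((E x)ᴴ * E y) = E y - Pd x * E y := by
    rw [← Matrix.mul_assoc, E_mul_conjTranspose, Matrix.sub_mul, Matrix.one_mul]
  rw [hop_eq, smul_mul_assoc, mul_smul_comm, Matrix.add_mul, Matrix.mul_add, m1, m2, m3, m4]
  module

/-- `[hop_{xy}, S⁺_y] = (P↓_y − ½) S⁺_x` (`x ≠ y`). [folklore] -/
theorem hop_mul_E_sub' (x y : Λ) (hxy : x ≠ y) :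
    hop x y * E y - E y * hop x y = Pd y * E x - (1 / 2 : ℂ) • E x := by
  rw [hop_comm]
  exact hop_mul_E_sub y x hxy.symm

/-- Locality: `hop_{xy}` commutes with every single-site operator away from `x, y`. [folklore] -/
theorem commute_hop_onSite {x y z : Λ} (hxz : x ≠ z) (hyz : y ≠ z) (a : Matrix (Fin 2) (Fin 2) ℂ) :
    Commute (hop x y) (onSite z a : Op Λ 2) := by
  have hx : ∀ α : Fin 3, Commute (siteSpin 1 x α) (onSite z a : Op Λ 2) := fun α =>
    onSite_mul_onSite_comm hxz _ _
  have hy : ∀ α : Fin 3, Commute (siteSpin 1 y α) (onSite z a : Op Λ 2) := fun α =>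
    onSite_mul_onSite_comm hyz _ _
  rw [hop]
  exact ((hx 0).mul_left (hy 0)).add_left ((hx 1).mul_left (hy 1))

/-- **`[hop_{xy}, S⁺_tot] = P↓_xS⁺_y + P↓_yS⁺_x − ½(S⁺_x + S⁺_y)`** (`x ≠ y`). [folklore] -/
theorem hop_mul_sumE_sub (x y : Λ) (hxy : x ≠ y) :
    hop x y * (∑ z : Λ, E z) - (∑ z : Λ, E z) * hop x y =
      Pd x * E y + Pd y * E x - (1 / 2 : ℂ) • (E x + E y) := by
  rw [Finset.mul_sum, Finset.sum_mul, ← Finset.sum_sub_distrib,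
    Finset.sum_eq_add_of_mem x y (Finset.mem_univ x) (Finset.mem_univ y) hxy (fun z _ hz => by
      rw [sub_eq_zero]; exact (commute_hop_onSite hz.1.symm hz.2.symm raise).eq),
    hop_mul_E_sub x y hxy, hop_mul_E_sub' x y hxy]
  module

/-- `[S⁻_x, K_{xy}]` for `K_{xy} = ½(S⁺_x + S⁺_y) − P↓_xS⁺_y − P↓_yS⁺_x` (`x ≠ y`):
`= (P↓_x − ½) + S⁻_xS⁺_y + P↓_y − 2P↓_yP↓_x`. [folklore] -/
theorem E_conjTranspose_mul_K_sub (x y : Λ) (hxy : x ≠ y) :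
    (E x)ᴴ * ((1 / 2 : ℂ) • (E x + E y) - Pd x * E y - Pd y * E x) -
      ((1 / 2 : ℂ) • (E x + E y) - Pd x * E y - Pd y * E x) * (E x)ᴴ =
      Pd x - (1 / 2 : ℂ) • 1 + (E x)ᴴ * E y + Pd y - (2 : ℂ) • (Pd y * Pd x) := by
  -- cross-site commutations
  have c1 : E y * (E x)ᴴ = (E x)ᴴ * E y := by
    rw [E_conjTranspose, E, onSite_mul_onSite_comm hxy.symm]
  have c2 : Pd y * (E x)ᴴ = (E x)ᴴ * Pd y := by
    rw [E_conjTranspose, Pd, onSite_mul_onSite_comm hxy.symm]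
  have c3 : E x * Pd y = Pd y * E x := by rw [E, Pd, onSite_mul_onSite_comm hxy]
  -- monomials, left products
  have l1 : (E x)ᴴ * E x = Pd x := E_conjTranspose_mul_E x
  have l3 : (E x)ᴴ * (Pd x * E y) = 0 := by
    rw [← Matrix.mul_assoc, E_conjTranspose_mul_Pd, Matrix.zero_mul]
  have l4 : (E x)ᴴ * (Pd y * E x) = Pd y * Pd x := by
    rw [← Matrix.mul_assoc, ← c2, Matrix.mul_assoc, l1]
  -- monomials, right products
  have r1 : E x * (E x)ᴴ = 1 - Pd x := E_mul_conjTranspose x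
  have r3 : Pd x * E y * (E x)ᴴ = (E x)ᴴ * E y := by
    rw [Matrix.mul_assoc, c1, ← Matrix.mul_assoc, Pd_mul_E_conjTranspose]
  have r4 : Pd y * E x * (E x)ᴴ = Pd y - Pd y * Pd x := by
    rw [Matrix.mul_assoc, r1, Matrix.mul_sub, Matrix.mul_one]
  rw [Matrix.mul_sub, Matrix.mul_sub, Matrix.sub_mul, Matrix.sub_mul, Matrix.mul_smul,
    Matrix.smul_mul, Matrix.mul_add, Matrix.add_mul, l1, c1, l3, l4, r1, r3, r4]
  module

/-- **The bond double commutator**: with `K'_{xy} = ½(S⁺_x + S⁺_y) − P↓_xS⁺_y − P↓_yS⁺_x`,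
`[S⁻_x + S⁻_y, K'_{xy}] = 2 hop_{xy} − 4 S³_xS³_y` (`x ≠ y`). [folklore] -/
theorem doubleComm_bond (x y : Λ) (hxy : x ≠ y) :
    ((E x)ᴴ + (E y)ᴴ) * ((1 / 2 : ℂ) • (E x + E y) - Pd x * E y - Pd y * E x) -
      ((1 / 2 : ℂ) • (E x + E y) - Pd x * E y - Pd y * E x) * ((E x)ᴴ + (E y)ᴴ) =
      (2 : ℂ) • hop x y - (4 : ℂ) • (siteSpin 1 x 2 * siteSpin 1 y 2) := by
  have hK : (1 / 2 : ℂ) • (E x + E y) - Pd x * E y - Pd y * E x =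
      (1 / 2 : ℂ) • (E y + E x) - Pd y * E x - Pd x * E y := by module
  have h1 := E_conjTranspose_mul_K_sub x y hxy
  have h2 := E_conjTranspose_mul_K_sub y x hxy.symm
  rw [← hK] at h2
  have hPP : Pd x * Pd y = Pd y * Pd x := by rw [Pd, Pd, onSite_mul_onSite_comm hxy]
  have hhop : (E x)ᴴ * E y + (E y)ᴴ * E x = (2 : ℂ) • hop x y := by
    have c : E x * (E y)ᴴ = (E y)ᴴ * E x := by
      rw [E_conjTranspose, E, onSite_mul_onSite_comm hxy]
    rw [hop_eq, smul_smul, c]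
    norm_num
    exact add_comm _ _
  have hS : siteSpin 1 x 2 * siteSpin 1 y 2 =
      (1 / 4 : ℂ) • 1 - (1 / 2 : ℂ) • Pd x - (1 / 2 : ℂ) • Pd y + Pd x * Pd y := by
    rw [siteSpin_two_eq, siteSpin_two_eq]
    simp only [Matrix.sub_mul, Matrix.mul_sub, Matrix.smul_mul, Matrix.mul_smul, Matrix.one_mul,
      Matrix.mul_one]
    module
  rw [Matrix.add_mul, Matrix.mul_add, add_sub_add_comm, h1, h2, hS, ← hhop, hPP]
  module

/-! #### Torus-level identities: `[H₀, S⁺_tot]`, the double commutator and its `O(|Λ|)` bound -/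

/-- `K'_{xy} = ½(S⁺_x + S⁺_y) − P↓_xS⁺_y − P↓_yS⁺_x` commutes with single-site operators away from
`x, y`. [folklore] -/
theorem commute_K_onSite {x y z : Λ} (hxz : x ≠ z) (hyz : y ≠ z) (a : Matrix (Fin 2) (Fin 2) ℂ) :
    Commute ((1 / 2 : ℂ) • (E x + E y) - Pd x * E y - Pd y * E x) (onSite z a : Op Λ 2) := by
  have hEx : Commute (E x) (onSite z a : Op Λ 2) := onSite_mul_onSite_comm hxz _ _
  have hEy : Commute (E y) (onSite z a : Op Λ 2) := onSite_mul_onSite_comm hyz _ _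
  have hPx : Commute (Pd x) (onSite z a : Op Λ 2) := onSite_mul_onSite_comm hxz _ _
  have hPy : Commute (Pd y) (onSite z a : Op Λ 2) := onSite_mul_onSite_comm hyz _ _
  exact (((hEx.add_left hEy).smul_left _).sub_left (hPx.mul_left hEy)).sub_left (hPy.mul_left hEx)

/-- **Quadratic-form bound on one bond**: `Re⟨ψ, (2 hop_{xy} − 4 S³_xS³_y) ψ⟩ ≤ 2‖ψ‖²`
(`|S^αS^α| ≤ ¼`). [folklore] -/
theorem re_quad_bond_le (x y : Λ) (ψ : TensorIndex Λ 2 → ℂ) :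
    (star ψ ⬝ᵥ ((2 : ℂ) • hop x y - (4 : ℂ) • (siteSpin 1 x 2 * siteSpin 1 y 2)) *ᵥ ψ).re ≤
      2 * (star ψ ⬝ᵥ ψ).re := by
  have hq : (((1 : ℕ) : ℂ) / 2) ^ 2 = ((1 / 4 : ℝ) : ℂ) := by push_cast; norm_num
  have hup : ∀ α : Fin 3, (star ψ ⬝ᵥ (siteSpin 1 x α * siteSpin 1 y α) *ᵥ ψ).re ≤
      1 / 4 * (star ψ ⬝ᵥ ψ).re := by
    intro α
    have h := (posSemidef_sq_smul_one_sub_siteSpin_mul' 1 x y α).dotProduct_mulVec_nonneg ψ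
    rw [hq, sub_mulVec, smul_mulVec, one_mulVec, dotProduct_sub, dotProduct_smul, smul_eq_mul] at h
    obtain ⟨hre, -⟩ := Complex.nonneg_iff.mp h
    rw [Complex.sub_re, Complex.re_ofReal_mul] at hre
    push_cast at hre
    linarith
  have hlo : -(star ψ ⬝ᵥ (siteSpin 1 x 2 * siteSpin 1 y 2) *ᵥ ψ).re ≤ 1 / 4 * (star ψ ⬝ᵥ ψ).re := by
    have h := (posSemidef_sq_smul_one_add_siteSpin_mul' 1 x y 2).dotProduct_mulVec_nonneg ψ
    rw [hq, add_mulVec, smul_mulVec, one_mulVec, dotProduct_add, dotProduct_smul, smul_eq_mul] at h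
    obtain ⟨hre, -⟩ := Complex.nonneg_iff.mp h
    rw [Complex.add_re, Complex.re_ofReal_mul] at hre
    push_cast at hre
    linarith
  have h2 : ((2 : ℂ)) = ((2 : ℝ) : ℂ) := by norm_num
  have h4 : ((4 : ℂ)) = ((4 : ℝ) : ℂ) := by norm_num
  rw [sub_mulVec, smul_mulVec, smul_mulVec, dotProduct_sub, dotProduct_smul, dotProduct_smul,
    smul_eq_mul, smul_eq_mul, Complex.sub_re, h2, h4, Complex.re_ofReal_mul, Complex.re_ofReal_mul,
    hop, add_mulVec, dotProduct_add, Complex.add_re]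
  linarith [hup 0, hup 1, hlo]

/-- **Symmetrisation of the excess energy of `A ψ`**: for a ground vector `ψ` of Hermitian `H`,
`Re⟨ψ, Aᴴ H A ψ⟩ − E₀ Re⟨ψ, AᴴA ψ⟩ ≤ Re⟨ψ, [Aᴴ, [H, A]] ψ⟩` (the dropped term is
`⟨Aᴴψ, (H − E₀) Aᴴψ⟩ ≥ 0`; the Koma–Tasaki / Pitaevskii–Stringari inequality). [folklore] -/
theorem re_excess_le_doubleComm {m : Type*} [Fintype m] [DecidableEq m] {H : Matrix m m ℂ}
    (hH : H.IsHermitian) (A : Matrix m m ℂ) {ψ : m → ℂ} (hψ : ψ ∈ H.groundSpace) :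
    (star ψ ⬝ᵥ (Aᴴ * H * A) *ᵥ ψ).re - H.groundEnergy * (star ψ ⬝ᵥ (Aᴴ * A) *ᵥ ψ).re ≤
      (star ψ ⬝ᵥ (Aᴴ * H * A - Aᴴ * A * H - H * A * Aᴴ + A * H * Aᴴ) *ᵥ ψ).re := by
  set E₀ := H.groundEnergy with hE
  have hHψ : H *ᵥ ψ = (E₀ : ℂ) • ψ := (mem_groundSpace_iff H ψ).mp hψ
  have hψH : star ψ ᵥ* H = (E₀ : ℂ) • star ψ := by
    have h := congrArg star hHψ
    rw [star_mulVec, hH.eq, star_smul] at h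
    rw [h, Complex.star_def, Complex.conj_ofReal]
  -- term 2: ⟨ψ, AᴴA H ψ⟩ = E₀ ⟨ψ, AᴴA ψ⟩
  have t2 : star ψ ⬝ᵥ (Aᴴ * A * H) *ᵥ ψ = (E₀ : ℂ) * (star ψ ⬝ᵥ (Aᴴ * A) *ᵥ ψ) := by
    rw [← mulVec_mulVec, hHψ, mulVec_smul, dotProduct_smul, smul_eq_mul]
  -- term 3: ⟨ψ, H A Aᴴ ψ⟩ = E₀ ‖Aᴴψ‖²
  have t3 : star ψ ⬝ᵥ (H * A * Aᴴ) *ᵥ ψ = (E₀ : ℂ) * (star (Aᴴ *ᵥ ψ) ⬝ᵥ (Aᴴ *ᵥ ψ)) := by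
    have hAA : A * Aᴴ = (Aᴴ)ᴴ * Aᴴ := by rw [conjTranspose_conjTranspose]
    rw [Matrix.mul_assoc, ← mulVec_mulVec, dotProduct_mulVec, hψH, smul_dotProduct, smul_eq_mul,
      hAA, star_dotProduct_conjTranspose_mul_mulVec]
  -- term 4: ⟨ψ, A H Aᴴ ψ⟩ = ⟨Aᴴψ, H Aᴴψ⟩
  have t4 : star ψ ⬝ᵥ (A * H * Aᴴ) *ᵥ ψ = star (Aᴴ *ᵥ ψ) ⬝ᵥ H *ᵥ (Aᴴ *ᵥ ψ) := by
    rw [Matrix.mul_assoc, ← mulVec_mulVec, dotProduct_mulVec, ← mulVec_mulVec]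
    congr 1
    rw [← conjTranspose_conjTranspose A, star_mulVec, conjTranspose_conjTranspose,
      conjTranspose_conjTranspose]
  -- positivity of the dropped term
  have hpos : 0 ≤ (star (Aᴴ *ᵥ ψ) ⬝ᵥ H *ᵥ (Aᴴ *ᵥ ψ)).re -
      E₀ * (star (Aᴴ *ᵥ ψ) ⬝ᵥ (Aᴴ *ᵥ ψ)).re := by
    have h := (posSemidef_sub_of_groundEnergy_le hH (le_refl H.groundEnergy)).dotProduct_mulVec_nonneg
      (Aᴴ *ᵥ ψ)
    rw [sub_mulVec, smul_mulVec, one_mulVec, dotProduct_sub, dotProduct_smul, smul_eq_mul] at h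
    obtain ⟨hre, -⟩ := Complex.nonneg_iff.mp h
    rw [Complex.sub_re, Complex.re_ofReal_mul] at hre
    exact hre
  rw [add_mulVec, sub_mulVec, sub_mulVec, dotProduct_add, dotProduct_sub, dotProduct_sub,
    Complex.add_re, Complex.sub_re, Complex.sub_re, t2, t3, t4, Complex.re_ofReal_mul,
    Complex.re_ofReal_mul]
  linarith

variable (L : ℕ) [NeZero L]

/-- `H_{L,0} = −Σ_x Σ_i hop(x, x+eᵢ)` (`L ≥ 3`). [folklore] -/
theorem hmu_zero_eq (hL : 3 ≤ L) :
    Hmu L 0 = -∑ x : TorusSite 3 L, ∑ i : Fin 3, hop x (x + Pi.single i 1) := by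
  rw [Hmu, xxz_eq L hL, Complex.ofReal_zero, zero_smul, sub_zero]

/-- **`U(1)` invariance of the crux Hamiltonian**: `[H_{L,μ}, S³_tot] = 0` (`L ≥ 3`). [folklore] -/
theorem commute_hmu_totalSpin_two (hL : 3 ≤ L) (μ : ℝ) :
    Commute (Hmu L μ) (totalSpin 1 2 : Op (TorusSite 3 L) 2) := by
  rw [Hmu, xxz_eq L hL]
  refine Commute.sub_left (Commute.neg_left ?_) ((Commute.refl _).smul_left _)
  exact Commute.sum_left _ _ _ fun x _ => Commute.sum_left _ _ _ fun i _ =>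
    commute_hop_totalSpin_two _ _

/-- **`[H_{L,0}, S⁺_tot] = Σ_x Σ_i K'(x, x+eᵢ)`** with
`K'_{xy} = ½(S⁺_x + S⁺_y) − P↓_xS⁺_y − P↓_yS⁺_x`. [folklore] -/
theorem hmu_zero_comm_sumE (hL : 3 ≤ L) :
    Hmu L 0 * (∑ z : TorusSite 3 L, E z) - (∑ z : TorusSite 3 L, E z) * Hmu L 0 =
      ∑ x : TorusSite 3 L, ∑ i : Fin 3,
        ((1 / 2 : ℂ) • (E x + E (x + Pi.single i 1)) - Pd x * E (x + Pi.single i 1) -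
          Pd (x + Pi.single i 1) * E x) := by
  have hL2 : 2 ≤ L := by omega
  set Ep : Op (TorusSite 3 L) 2 := ∑ z : TorusSite 3 L, E z with hEp
  rw [hmu_zero_eq L hL, neg_mul, mul_neg, sub_neg_eq_add, neg_add_eq_sub]
  simp only [Finset.sum_mul, Finset.mul_sum, ← Finset.sum_sub_distrib]
  refine Finset.sum_congr rfl fun x _ => Finset.sum_congr rfl fun i _ => ?_
  have hne : x ≠ x + Pi.single i 1 := fun h => torus_single_ne_zero hL2 i (left_eq_add.mp h)
  rw [← neg_sub, hEp, hop_mul_sumE_sub x _ hne]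
  module

/-- **The double commutator `[S⁻_tot, [H_{L,0}, S⁺_tot]] = Σ_x Σ_i (2 hop − 4 S³S³)(x, x+eᵢ)`**
(`L ≥ 3`). [folklore] -/
theorem doubleComm_eq (hL : 3 ≤ L) :
    (∑ z : TorusSite 3 L, E z)ᴴ * (Hmu L 0 * (∑ z : TorusSite 3 L, E z) -
        (∑ z : TorusSite 3 L, E z) * Hmu L 0) -
      (Hmu L 0 * (∑ z : TorusSite 3 L, E z) - (∑ z : TorusSite 3 L, E z) * Hmu L 0) *
        (∑ z : TorusSite 3 L, E z)ᴴ =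
      ∑ x : TorusSite 3 L, ∑ i : Fin 3,
        ((2 : ℂ) • hop x (x + Pi.single i 1) -
          (4 : ℂ) • (siteSpin 1 x 2 * siteSpin 1 (x + Pi.single i 1) 2)) := by
  have hL2 : 2 ≤ L := by omega
  rw [hmu_zero_comm_sumE L hL]
  rw [Finset.mul_sum, Finset.sum_mul, ← Finset.sum_sub_distrib]
  refine Finset.sum_congr rfl fun x _ => ?_
  rw [Finset.mul_sum, Finset.sum_mul, ← Finset.sum_sub_distrib]
  refine Finset.sum_congr rfl fun i _ => ?_
  have hne : x ≠ x + Pi.single i 1 := fun h => torus_single_ne_zero hL2 i (left_eq_add.mp h)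
  set y := x + Pi.single i 1 with hy
  set K := (1 / 2 : ℂ) • (E x + E y) - Pd x * E y - Pd y * E x with hK
  rw [Matrix.conjTranspose_sum, Finset.sum_mul, Finset.mul_sum, ← Finset.sum_sub_distrib,
    Finset.sum_eq_add_of_mem x y (Finset.mem_univ x) (Finset.mem_univ y) hne (fun z _ hz => by
      rw [sub_eq_zero, E_conjTranspose]
      exact ((commute_K_onSite hz.1.symm hz.2.symm raiseᴴ).eq).symm)]
  have h := doubleComm_bond x y hne
  rw [← hK] at h
  rw [← h, Matrix.add_mul, Matrix.mul_add]
  abel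

/-- **`O(|Λ|)` bound on the double commutator**: `Re⟨ψ, [S⁻_tot,[H_{L,0},S⁺_tot]] ψ⟩ ≤ 6|Λ|‖ψ‖²`.
[folklore] -/
theorem re_doubleComm_le (hL : 3 ≤ L) (ψ : TensorIndex (TorusSite 3 L) 2 → ℂ) :
    (star ψ ⬝ᵥ ((∑ z : TorusSite 3 L, E z)ᴴ * (Hmu L 0 * (∑ z : TorusSite 3 L, E z) -
        (∑ z : TorusSite 3 L, E z) * Hmu L 0) -
      (Hmu L 0 * (∑ z : TorusSite 3 L, E z) - (∑ z : TorusSite 3 L, E z) * Hmu L 0) *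
        (∑ z : TorusSite 3 L, E z)ᴴ) *ᵥ ψ).re ≤
      6 * (Fintype.card (TorusSite 3 L) : ℝ) * (star ψ ⬝ᵥ ψ).re := by
  rw [doubleComm_eq L hL, Matrix.sum_mulVec, dotProduct_sum, Complex.re_sum]
  calc ∑ x : TorusSite 3 L, (star ψ ⬝ᵥ (∑ i : Fin 3, ((2 : ℂ) • hop x (x + Pi.single i 1) -
          (4 : ℂ) • (siteSpin 1 x 2 * siteSpin 1 (x + Pi.single i 1) 2))) *ᵥ ψ).re
      ≤ ∑ x : TorusSite 3 L, 3 * (2 * (star ψ ⬝ᵥ ψ).re) := by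
        refine Finset.sum_le_sum fun x _ => ?_
        rw [Matrix.sum_mulVec, dotProduct_sum, Complex.re_sum]
        calc ∑ i : Fin 3, (star ψ ⬝ᵥ ((2 : ℂ) • hop x (x + Pi.single i 1) -
              (4 : ℂ) • (siteSpin 1 x 2 * siteSpin 1 (x + Pi.single i 1) 2)) *ᵥ ψ).re
            ≤ ∑ i : Fin 3, 2 * (star ψ ⬝ᵥ ψ).re :=
              Finset.sum_le_sum fun i _ => re_quad_bond_le _ _ ψ
          _ = 3 * (2 * (star ψ ⬝ᵥ ψ).re) := by
              rw [Finset.sum_const, Finset.card_univ, Fintype.card_fin, nsmul_eq_mul, Nat.cast_ofNat]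
    _ = 6 * (Fintype.card (TorusSite 3 L) : ℝ) * (star ψ ⬝ᵥ ψ).re := by
        rw [Finset.sum_const, Finset.card_univ, nsmul_eq_mul]
        ring

/-! #### The argument -/

/-- `‖Uψ‖² = ‖ψ‖²` for `UᴴU = 1`. [folklore] -/
theorem star_mulVec_dotProduct_mulVec {U : Op Λ 2} (hU : Uᴴ * U = 1)
    (ψ : TensorIndex Λ 2 → ℂ) : star (U *ᵥ ψ) ⬝ᵥ (U *ᵥ ψ) = star ψ ⬝ᵥ ψ := by
  rw [star_mulVec, ← dotProduct_mulVec, mulVec_mulVec, hU, one_mulVec]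

/-- `S³_tot U = −U S³_tot` for the flip `U`. [folklore] -/
theorem totalSpin_two_mul_flipOp :
    (totalSpin 1 2 : Op Λ 2) * flipOp = -(flipOp * totalSpin 1 2) := by
  have h := congrArg (· * flipOp) (flip_conj_totalSpin_two (Λ := Λ))
  rw [Matrix.mul_assoc, flipOp_conjTranspose_mul, Matrix.mul_one, Matrix.neg_mul] at h
  exact (neg_eq_iff_eq_neg.mpr h).symm

/-- `U H_{L,μ} = H_{L,−μ} U` (`L ≥ 3`). [folklore] -/
theorem flipOp_mul_hmu (hL : 3 ≤ L) (μ : ℝ) : flipOp * Hmu L μ = Hmu L (-μ) * flipOp := by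
  have h := congrArg (· * flipOp) (flip_conj_hmu L hL μ)
  rwa [Matrix.mul_assoc, flipOp_conjTranspose_mul, Matrix.mul_one] at h

/-- **Core of the argument** (`μ > 0`, fixed torus of side `L ≥ 3`): if the `μ = 0` tracial ground
state has `Re ω₀(Σ_{x,y} hop) ≥ c₀|Λ|²` and `c₀ μ |Λ| > 6`, then NO nonzero ground vector of
`H_{L,μ}` is half filled (`S³_tot v = 0`). Koma–Tasaki: a half-filled ground vector would give
`E₀(μ) ≥ E₀(0)`, while the columns of `P₀(H_{L,0})` (simultaneous `S³_tot`-eigenvectors, one of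
which inherits the order, `exists_col_quad_ge`) give trial states — themselves or their flips if
`M ≠ 0`, `S⁺_tot ψ` if `M = 0` — of energy `< E₀(0)` at chemical potential `μ`
(`re_excess_le_doubleComm`, `re_doubleComm_le`). [folklore] -/
theorem offHalf_core (hL : 3 ≤ L) {μ c₀ : ℝ} (hμ : 0 < μ) (hc₀ : 0 < c₀)
    (hLRO : c₀ * (Fintype.card (TorusSite 3 L) : ℝ) ^ 2 ≤
      ((Hmu L 0).groundStateFunctional (∑ x : TorusSite 3 L, ∑ y : TorusSite 3 L, hop x y)).re)
    (hbig : 6 < c₀ * μ * Fintype.card (TorusSite 3 L))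
    {v : TensorIndex (TorusSite 3 L) 2 → ℂ} (hv : v ∈ (Hmu L μ).groundSpace)
    (hS : (totalSpin 1 2 : Op (TorusSite 3 L) 2) *ᵥ v = 0) : v = 0 := by
  by_contra hv0
  set H₀ : Op (TorusSite 3 L) 2 := Hmu L 0 with hH₀
  set Hμ : Op (TorusSite 3 L) 2 := Hmu L μ with hHμ
  set S3 : Op (TorusSite 3 L) 2 := totalSpin 1 2 with hS3
  set Ep : Op (TorusSite 3 L) 2 := ∑ z : TorusSite 3 L, E z with hEp
  set O : Op (TorusSite 3 L) 2 := ∑ x : TorusSite 3 L, ∑ y : TorusSite 3 L, hop x y with hO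
  set N : ℝ := (Fintype.card (TorusSite 3 L) : ℝ) with hN
  have hH₀h : H₀.IsHermitian := Hmu_isHermitian L 0
  have hHμh : Hμ.IsHermitian := Hmu_isHermitian L μ
  have hNpos : 0 < N := by
    have : 6 < c₀ * μ * N := hbig
    nlinarith [mul_pos hc₀ hμ]
  -- norms of nonzero vectors are positive
  have npos : ∀ φ : TensorIndex (TorusSite 3 L) 2 → ℂ, φ ≠ 0 → 0 < (star φ ⬝ᵥ φ).re := by
    intro φ hφ
    have hnn : 0 ≤ (star φ ⬝ᵥ φ).re := (Complex.nonneg_iff.mp (dotProduct_star_self_nonneg φ)).1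
    rcases hnn.lt_or_eq with hlt | heq
    · exact hlt
    · exfalso
      apply hφ
      apply dotProduct_star_self_eq_zero.mp
      rw [star_dotProduct_self_eq_ofReal, ← heq]
      simp
  -- the two Hamiltonians on vectors
  have hHμ_eq : ∀ φ : TensorIndex (TorusSite 3 L) 2 → ℂ,
      Hμ *ᵥ φ = H₀ *ᵥ φ - (μ : ℂ) • (S3 *ᵥ φ) := by
    intro φ
    rw [hHμ, hH₀, Hmu, Hmu, sub_mulVec, sub_mulVec, smul_mulVec, smul_mulVec, ← hS3,
      Complex.ofReal_zero, zero_smul, sub_zero]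
  -- Rayleigh: E₀(μ)‖φ‖² ≤ Re⟨φ, Hμ φ⟩ ; and E₀(0)‖φ‖² ≤ Re⟨φ, H₀ φ⟩
  have ray : ∀ (K : Op (TorusSite 3 L) 2), K.IsHermitian → ∀ φ : TensorIndex (TorusSite 3 L) 2 → ℂ,
      K.groundEnergy * (star φ ⬝ᵥ φ).re ≤ (star φ ⬝ᵥ K *ᵥ φ).re := by
    intro K hK φ
    have h := (posSemidef_sub_of_groundEnergy_le hK (le_refl _)).dotProduct_mulVec_nonneg φ
    rw [sub_mulVec, smul_mulVec, one_mulVec, dotProduct_sub, dotProduct_smul, smul_eq_mul] at h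
    obtain ⟨hre, -⟩ := Complex.nonneg_iff.mp h
    rw [Complex.sub_re, Complex.re_ofReal_mul] at hre
    linarith
  -- (b) lower bound E₀(0) ≤ E₀(μ) from the half-filled ground vector v
  have hlow : H₀.groundEnergy ≤ Hμ.groundEnergy := by
    have nv := npos v hv0
    have h1 : (star v ⬝ᵥ Hμ *ᵥ v).re = Hμ.groundEnergy * (star v ⬝ᵥ v).re := by
      rw [(mem_groundSpace_iff Hμ v).mp hv, dotProduct_smul, smul_eq_mul, Complex.re_ofReal_mul]
    have h2 := ray H₀ hH₀h v
    rw [← show Hμ *ᵥ v = H₀ *ᵥ v by rw [hHμ_eq, hS, smul_zero, sub_zero], h1] at h2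
    exact le_of_mul_le_mul_right h2 nv
  -- (c) a ground vector of H₀ with the order, an S³-eigenvector
  obtain ⟨σ, hψ0, hψO⟩ := exists_col_quad_ge hH₀h O (c₀ * N ^ 2) hLRO
  set ψ := H₀.groundProj.col σ with hψdef
  have hψmem : ψ ∈ H₀.groundSpace := groundProj_col_mem H₀ σ
  have hH₀ψ : H₀ *ᵥ ψ = (H₀.groundEnergy : ℂ) • ψ := (mem_groundSpace_iff H₀ ψ).mp hψmem
  have nψ := npos ψ hψ0
  set M : ℝ := N / 2 - (downCount σ : ℝ) with hM
  have hS3ψ : S3 *ᵥ ψ = (M : ℂ) • ψ := by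
    have hc : S3 * H₀ = H₀ * S3 := (commute_hmu_totalSpin_two L hL 0).symm.eq
    have hP := groundProj_commute_of_commute hH₀h hc
    rw [hψdef, ← mulVec_single_one, mulVec_mulVec, ← hP, ← mulVec_mulVec, hS3,
      totalSpin_two_mulVec_single, mulVec_smul]
    congr 1
    rw [hM, hN]
    push_cast
    ring
  have hψH₀ : (star ψ ⬝ᵥ H₀ *ᵥ ψ).re = H₀.groundEnergy * (star ψ ⬝ᵥ ψ).re := by
    rw [hH₀ψ, dotProduct_smul, smul_eq_mul, Complex.re_ofReal_mul]
  have hψS3 : (star ψ ⬝ᵥ S3 *ᵥ ψ).re = M * (star ψ ⬝ᵥ ψ).re := by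
    rw [hS3ψ, dotProduct_smul, smul_eq_mul, Complex.re_ofReal_mul]
  by_cases hM0 : M = 0
  · -- Case M = 0 : trial state w = S⁺_tot ψ
    set w := Ep *ᵥ ψ with hw
    have hEE : Epᴴ * Ep = O - S3 := by
      rw [hO, sum_hop_eq, ← hEp, ← hS3, add_sub_cancel_right]
    have hnw : (star w ⬝ᵥ w).re = (star ψ ⬝ᵥ O *ᵥ ψ).re := by
      rw [hw, ← star_dotProduct_conjTranspose_mul_mulVec, hEE, sub_mulVec, dotProduct_sub,
        Complex.sub_re, hψS3, hM0, zero_mul, sub_zero]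
    have hnw_ge : c₀ * N ^ 2 * (star ψ ⬝ᵥ ψ).re ≤ (star w ⬝ᵥ w).re := by rw [hnw]; exact hψO
    have nw : 0 < (star w ⬝ᵥ w).re := lt_of_lt_of_le (by positivity) hnw_ge
    have hS3w : S3 *ᵥ w = w := by
      rw [hw, mulVec_mulVec, hS3, hEp, totalSpin_two_mul_sumE, ← hEp, ← hS3, add_mulVec,
        ← mulVec_mulVec, hS3ψ, hM0, Complex.ofReal_zero, zero_smul, mulVec_zero, zero_add]
    -- energies of w
    have hwH₀ : (star w ⬝ᵥ H₀ *ᵥ w).re = (star ψ ⬝ᵥ (Epᴴ * H₀ * Ep) *ᵥ ψ).re := by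
      rw [hw, ← mulVec_mulVec, ← mulVec_mulVec, dotProduct_mulVec (star ψ) Epᴴ, ← star_mulVec]
    have hwEE : (star w ⬝ᵥ w).re = (star ψ ⬝ᵥ (Epᴴ * Ep) *ᵥ ψ).re := by
      rw [hw, star_dotProduct_conjTranspose_mul_mulVec]
    have hexc := re_excess_le_doubleComm hH₀h Ep hψmem
    have hDeq : Epᴴ * H₀ * Ep - Epᴴ * Ep * H₀ - H₀ * Ep * Epᴴ + Ep * H₀ * Epᴴ =
        Epᴴ * (H₀ * Ep - Ep * H₀) - (H₀ * Ep - Ep * H₀) * Epᴴ := by noncomm_ring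
    rw [hDeq, ← hwH₀, ← hwEE] at hexc
    have hD := re_doubleComm_le L hL ψ
    rw [← hEp, ← hH₀] at hD
    -- Rayleigh at w for Hμ
    have hray := ray Hμ hHμh w
    rw [hHμ_eq, hS3w, dotProduct_sub, dotProduct_smul, smul_eq_mul, Complex.sub_re,
      Complex.re_ofReal_mul] at hray
    -- combine (all linear from here)
    have h1 : H₀.groundEnergy * (star w ⬝ᵥ w).re ≤ Hμ.groundEnergy * (star w ⬝ᵥ w).re :=
      mul_le_mul_of_nonneg_right hlow nw.le
    have key : μ * (star w ⬝ᵥ w).re ≤ 6 * N * (star ψ ⬝ᵥ ψ).re := by linarith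
    have key2 : μ * (c₀ * N ^ 2 * (star ψ ⬝ᵥ ψ).re) ≤ 6 * N * (star ψ ⬝ᵥ ψ).re :=
      le_trans (mul_le_mul_of_nonneg_left hnw_ge hμ.le) key
    have hposNn : 0 < N * (star ψ ⬝ᵥ ψ).re := mul_pos hNpos nψ
    have h3 : (c₀ * μ * N) * (N * (star ψ ⬝ᵥ ψ).re) ≤ 6 * (N * (star ψ ⬝ᵥ ψ).re) :=
      calc (c₀ * μ * N) * (N * (star ψ ⬝ᵥ ψ).re) = μ * (c₀ * N ^ 2 * (star ψ ⬝ᵥ ψ).re) := by ring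
        _ ≤ 6 * N * (star ψ ⬝ᵥ ψ).re := key2
        _ = 6 * (N * (star ψ ⬝ᵥ ψ).re) := by ring
    have h4 := mul_lt_mul_of_pos_right hbig hposNn
    linarith
  · -- Case M ≠ 0 : ψ and its flip
    have hray1 := ray Hμ hHμh ψ
    rw [hHμ_eq, dotProduct_sub, dotProduct_smul, smul_eq_mul, Complex.sub_re, Complex.re_ofReal_mul,
      hψH₀, hψS3] at hray1
    -- the flipped vector
    set φ := (flipOp : Op (TorusSite 3 L) 2) *ᵥ ψ with hφ
    have hnφ : (star φ ⬝ᵥ φ).re = (star ψ ⬝ᵥ ψ).re := by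
      rw [hφ, star_mulVec_dotProduct_mulVec flipOp_conjTranspose_mul]
    have hH₀φ : H₀ *ᵥ φ = (H₀.groundEnergy : ℂ) • φ := by
      have hcomm : flipOp * H₀ = H₀ * flipOp := by
        have := flipOp_mul_hmu L hL 0
        rwa [neg_zero] at this
      rw [hφ, mulVec_mulVec, ← hcomm, ← mulVec_mulVec, hH₀ψ, mulVec_smul]
    have hS3φ : S3 *ᵥ φ = (-(M : ℂ)) • φ := by
      rw [hφ, mulVec_mulVec, hS3, totalSpin_two_mul_flipOp, Matrix.neg_mulVec, ← hS3,
        ← mulVec_mulVec, hS3ψ, mulVec_smul, neg_smul]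
    have hφH₀ : (star φ ⬝ᵥ H₀ *ᵥ φ).re = H₀.groundEnergy * (star ψ ⬝ᵥ ψ).re := by
      rw [hH₀φ, dotProduct_smul, smul_eq_mul, Complex.re_ofReal_mul, hnφ]
    have hφS3 : (star φ ⬝ᵥ S3 *ᵥ φ).re = -M * (star ψ ⬝ᵥ ψ).re := by
      rw [hS3φ, dotProduct_smul, smul_eq_mul, ← Complex.ofReal_neg, Complex.re_ofReal_mul, hnφ]
    have hray2 := ray Hμ hHμh φ
    rw [hHμ_eq, dotProduct_sub, dotProduct_smul, smul_eq_mul, Complex.sub_re, Complex.re_ofReal_mul,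
      hφH₀, hφS3, hnφ] at hray2
    have h1 : H₀.groundEnergy * (star ψ ⬝ᵥ ψ).re ≤ Hμ.groundEnergy * (star ψ ⬝ᵥ ψ).re :=
      mul_le_mul_of_nonneg_right hlow nψ.le
    have hA : μ * (M * (star ψ ⬝ᵥ ψ).re) ≤ 0 := by linarith
    have hB : 0 ≤ μ * (M * (star ψ ⬝ᵥ ψ).re) := by linarith
    have hz : μ * (M * (star ψ ⬝ᵥ ψ).re) = 0 := le_antisymm hA hB
    rcases mul_eq_zero.mp hz with h | h
    · linarith
    · rcases mul_eq_zero.mp h with h' | h'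
      · exact hM0 h'
      · linarith

/-- The `k`-th liminf term of the crux at `μ`, in the form `Re ω_{2k,μ}(Σ hop)/(2k)⁶` (`k ≥ 2`).
[folklore] -/
theorem orderParam_eq_re_gsf (μ : ℝ) {k : ℕ} (_hk : 2 ≤ k) [NeZero (2 * k)] :
    (∑ x ∈ halfOpenBox 3 (2 * k), ∑ y ∈ halfOpenBox 3 (2 * k),
      torusPullback (d := 3) (fun L x y => if hL : L = 0 then 0 else (haveI : NeZero L := ⟨hL⟩;
        (∑ α : Fin 2, (xxzHamiltonian 1 (torusGraph 3 L) (-1) 0 -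
          (μ : ℂ) • totalSpin 1 2).groundStateFunctional
          (siteSpin 1 x (Fin.castSucc α) * siteSpin 1 y (Fin.castSucc α))).re)) (2 * k) x y) /
      ((halfOpenBox 3 (2 * k)).card : ℝ) ^ 2 =
    ((Hmu (2 * k) μ).groundStateFunctional
      (∑ s : TorusSite 3 (2 * k), ∑ t : TorusSite 3 (2 * k), hop s t)).re /
      (((2 * k : ℕ) : ℝ) ^ 3) ^ 2 := by
  have hL0 : 2 * k ≠ 0 := NeZero.ne _
  simp only [torusPullback_apply, dif_neg hL0]
  rw [sum_sq_halfOpenBox_comp_torusProj (fun s t : TorusSite 3 (2 * k) =>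
    (∑ α : Fin 2, (Hmu (2 * k) μ).groundStateFunctional
      (siteSpin 1 s (Fin.castSucc α) * siteSpin 1 t (Fin.castSucc α))).re)]
  have hsum : (∑ s : TorusSite 3 (2 * k), ∑ t : TorusSite 3 (2 * k),
      (∑ α : Fin 2, (Hmu (2 * k) μ).groundStateFunctional
        (siteSpin 1 s (Fin.castSucc α) * siteSpin 1 t (Fin.castSucc α))).re) =
      ((Hmu (2 * k) μ).groundStateFunctional
        (∑ s : TorusSite 3 (2 * k), ∑ t : TorusSite 3 (2 * k), hop s t)).re := by
    simp only [map_sum, Complex.re_sum]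
    refine Finset.sum_congr rfl fun s _ => Finset.sum_congr rfl fun t _ => ?_
    rw [Fin.sum_univ_two, hop, map_add, Complex.add_re]
    rfl
  rw [hsum, card_halfOpenBox]
  push_cast
  ring

/-- **OFF HALF FILLING IS FORCED.** For every `μ ≠ 0` there is `L₀` such that on every even torus
of side `L ≥ L₀` NO nonzero ground vector of the crux Hamiltonian `H_{L,μ}` is half filled
(`S³_tot v = 0 → v = 0`): the KLS ground state does not survive any fixed chemical potential, so a
proof of the crux must control ground states in sectors `S³_tot ≠ 0`, where site-local reflection
positivity of the state is unavailable (`HalfFillingReflectionPositivityNarrow`). Ingredients: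
the in-tree KLS theorem quantitatively (`lroAt_zero`, `orderParam_eq_re_gsf`), the Koma–Tasaki
trial states of `offHalf_core`, and the flip `U` for `μ < 0`. [folklore] -/
theorem offHalfFilling_forced {μ : ℝ} (hμ : μ ≠ 0) :
    ∃ L₀ : ℕ, ∀ (L : ℕ) [NeZero L], L₀ ≤ L → Even L →
      ∀ v ∈ (Hmu L μ).groundSpace, (totalSpin 1 2 : Op (TorusSite 3 L) 2) *ᵥ v = 0 → v = 0 := by
  obtain ⟨f, hfpos, hf0, hfk⟩ : ∃ f : ℕ → ℝ, 0 < Filter.liminf f Filter.atTop ∧ (∀ k, 0 ≤ f k) ∧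
      ∀ k : ℕ, 2 ≤ k → ∀ [NeZero (2 * k)], f k = ((Hmu (2 * k) 0).groundStateFunctional
        (∑ s : TorusSite 3 (2 * k), ∑ t : TorusSite 3 (2 * k), hop s t)).re /
        (((2 * k : ℕ) : ℝ) ^ 3) ^ 2 := by
    have h := lroAt_zero
    unfold LROAt at h
    exact ⟨_, h, fun k => orderParam_nonneg 0 k, fun k hk _ => orderParam_eq_re_gsf 0 hk⟩
  set c₀ : ℝ := Filter.liminf f Filter.atTop / 2 with hc₀
  have hc₀pos : 0 < c₀ := by positivity
  have hev1 : ∀ᶠ k : ℕ in Filter.atTop, c₀ < f k :=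
    Filter.eventually_lt_of_lt_liminf (by linarith : c₀ < Filter.liminf f Filter.atTop)
      ⟨0, Filter.eventually_map.mpr (Filter.Eventually.of_forall fun k => hf0 k)⟩
  have hT : Filter.Tendsto (fun k : ℕ => c₀ * |μ| * ((2 * k : ℕ) : ℝ) ^ 3) Filter.atTop Filter.atTop := by
    refine Filter.Tendsto.const_mul_atTop (mul_pos hc₀pos (abs_pos.mpr hμ)) ?_
    refine (Filter.tendsto_pow_atTop (by norm_num)).comp ?_
    exact tendsto_natCast_atTop_atTop.comp (Filter.tendsto_id.const_mul_atTop' (by norm_num))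
  have hev2 : ∀ᶠ k : ℕ in Filter.atTop, 6 < c₀ * |μ| * ((2 * k : ℕ) : ℝ) ^ 3 :=
    hT.eventually_gt_atTop 6
  obtain ⟨k₀, hk₀⟩ := Filter.eventually_atTop.mp (hev1.and (hev2.and (Filter.eventually_ge_atTop 2)))
  refine ⟨2 * k₀, ?_⟩
  intro L inst hL hEven v hv hS
  obtain ⟨k, rfl⟩ := hEven.two_dvd
  obtain ⟨h1, h2, h3⟩ := hk₀ k (by omega)
  have hL3 : 3 ≤ 2 * k := by omega
  rw [hfk k h3] at h1
  have hcardN : Fintype.card (TorusSite 3 (2 * k)) = (2 * k) ^ 3 := by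
    simp [ZMod.card, Fintype.card_fin]
  have hcard : (Fintype.card (TorusSite 3 (2 * k)) : ℝ) = ((2 * k : ℕ) : ℝ) ^ 3 := by
    rw [hcardN]
    push_cast
    ring
  have hX : (0 : ℝ) < ((2 * k : ℕ) : ℝ) ^ 3 := by positivity
  have hLRO : c₀ * (Fintype.card (TorusSite 3 (2 * k)) : ℝ) ^ 2 ≤
      ((Hmu (2 * k) 0).groundStateFunctional
        (∑ s : TorusSite 3 (2 * k), ∑ t : TorusSite 3 (2 * k), hop s t)).re := by
    rw [hcard]
    rw [lt_div_iff₀ (by positivity)] at h1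
    linarith
  have hbig : 6 < c₀ * |μ| * Fintype.card (TorusSite 3 (2 * k)) := by rw [hcard]; exact h2
  rcases lt_or_gt_of_ne hμ with hneg | hpos
  · -- μ < 0 : transport along the flip to −μ > 0
    have hbig' : 6 < c₀ * (-μ) * Fintype.card (TorusSite 3 (2 * k)) := by
      rwa [abs_of_neg hneg] at hbig
    have hUv : flipOp *ᵥ v ∈ (Hmu (2 * k) (-μ)).groundSpace := by
      rw [mem_groundSpace_iff]
      have hE : (Hmu (2 * k) (-μ)).groundEnergy = (Hmu (2 * k) μ).groundEnergy := by
        rw [← flip_conj_hmu (2 * k) hL3 μ]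
        refine groundEnergy_unitary_conj (Matrix.mem_unitaryGroup_iff.mpr ?_)
        rw [star_eq_conjTranspose]
        exact flipOp_mul_conjTranspose
      rw [hE, mulVec_mulVec, ← flipOp_mul_hmu (2 * k) hL3 μ, ← mulVec_mulVec,
        (mem_groundSpace_iff _ v).mp hv, mulVec_smul]
    have hSU : (totalSpin 1 2 : Op (TorusSite 3 (2 * k)) 2) *ᵥ (flipOp *ᵥ v) = 0 := by
      rw [mulVec_mulVec, totalSpin_two_mul_flipOp, Matrix.neg_mulVec, ← mulVec_mulVec, hS,
        mulVec_zero, neg_zero]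
    have hUv0 := offHalf_core (2 * k) hL3 (by linarith : 0 < -μ) hc₀pos hLRO hbig' hUv hSU
    have hv' : v = flipOpᴴ *ᵥ (flipOp *ᵥ v) := by
      rw [mulVec_mulVec, flipOp_conjTranspose_mul, one_mulVec]
    rw [hv', hUv0, mulVec_zero]
  · have hbig' : 6 < c₀ * μ * Fintype.card (TorusSite 3 (2 * k)) := by
      rwa [abs_of_pos hpos] at hbig
    exact offHalf_core (2 * k) hL3 hpos hc₀pos hLRO hbig' hv hS

/-- **The grand-canonical ground energy is maximal at half filling**: `E₀(H_{L,μ}) ≤ E₀(H_{L,0})`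
for every `μ` (`L ≥ 3`). A nonzero column `ψ` of `P₀(H_{L,0})` is an `S³_tot`-eigenvector
(`S³ψ = Mψ`); `ψ` (if `μM ≥ 0`) or its flip `Uψ` (if `μM ≤ 0`) has energy `E₀(0) − |μM| ≤ E₀(0)`
at chemical potential `μ`. (Input for the provers' `μ`-deformed bond-energy bound (D_μ):
`ω_μ(H_XY) = E₀(μ) + μ ω_μ(S³_tot) ≤ E₀(0) + |μ||Λ|/2`.) [folklore] -/
theorem groundEnergy_hmu_le_zero (hL : 3 ≤ L) (μ : ℝ) :
    (Hmu L μ).groundEnergy ≤ (Hmu L 0).groundEnergy := by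
  set H₀ : Op (TorusSite 3 L) 2 := Hmu L 0 with hH₀
  set Hμ : Op (TorusSite 3 L) 2 := Hmu L μ with hHμ
  set S3 : Op (TorusSite 3 L) 2 := totalSpin 1 2 with hS3
  have hH₀h : H₀.IsHermitian := Hmu_isHermitian L 0
  have hHμh : Hμ.IsHermitian := Hmu_isHermitian L μ
  -- a nonzero column of P₀(H₀)
  obtain ⟨σ, hψ0⟩ : ∃ σ, H₀.groundProj.col σ ≠ 0 := by
    by_contra hall
    push Not at hall
    apply groundProj_ne_zero hH₀h
    ext a σ
    have := congrFun (hall σ) a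
    simpa [Matrix.col_apply] using this
  set ψ := H₀.groundProj.col σ with hψdef
  have hψmem : ψ ∈ H₀.groundSpace := groundProj_col_mem H₀ σ
  have hH₀ψ : H₀ *ᵥ ψ = (H₀.groundEnergy : ℂ) • ψ := (mem_groundSpace_iff H₀ ψ).mp hψmem
  have nψ : 0 < (star ψ ⬝ᵥ ψ).re := by
    have hnn : 0 ≤ (star ψ ⬝ᵥ ψ).re := (Complex.nonneg_iff.mp (dotProduct_star_self_nonneg ψ)).1
    rcases hnn.lt_or_eq with hlt | heq
    · exact hlt
    · exfalso
      apply hψ0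
      apply dotProduct_star_self_eq_zero.mp
      rw [star_dotProduct_self_eq_ofReal, ← heq]
      simp
  set M : ℝ := (Fintype.card (TorusSite 3 L) : ℝ) / 2 - (downCount σ : ℝ) with hM
  have hS3ψ : S3 *ᵥ ψ = (M : ℂ) • ψ := by
    have hc : S3 * H₀ = H₀ * S3 := (commute_hmu_totalSpin_two L hL 0).symm.eq
    have hP := groundProj_commute_of_commute hH₀h hc
    rw [hψdef, ← mulVec_single_one, mulVec_mulVec, ← hP, ← mulVec_mulVec, hS3,
      totalSpin_two_mulVec_single, mulVec_smul]
    congr 1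
    rw [hM]
    push_cast
    ring
  have hHμ_eq : ∀ φ : TensorIndex (TorusSite 3 L) 2 → ℂ,
      Hμ *ᵥ φ = H₀ *ᵥ φ - (μ : ℂ) • (S3 *ᵥ φ) := by
    intro φ
    rw [hHμ, hH₀, Hmu, Hmu, sub_mulVec, sub_mulVec, smul_mulVec, smul_mulVec, ← hS3,
      Complex.ofReal_zero, zero_smul, sub_zero]
  have ray : ∀ φ : TensorIndex (TorusSite 3 L) 2 → ℂ,
      Hμ.groundEnergy * (star φ ⬝ᵥ φ).re ≤ (star φ ⬝ᵥ Hμ *ᵥ φ).re := by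
    intro φ
    have h := (posSemidef_sub_of_groundEnergy_le hHμh (le_refl _)).dotProduct_mulVec_nonneg φ
    rw [sub_mulVec, smul_mulVec, one_mulVec, dotProduct_sub, dotProduct_smul, smul_eq_mul] at h
    obtain ⟨hre, -⟩ := Complex.nonneg_iff.mp h
    rw [Complex.sub_re, Complex.re_ofReal_mul] at hre
    linarith
  -- energies of ψ and of its flip φ
  have hray1 := ray ψ
  rw [hHμ_eq, dotProduct_sub, dotProduct_smul, smul_eq_mul, Complex.sub_re, Complex.re_ofReal_mul,
    hH₀ψ, dotProduct_smul, smul_eq_mul, Complex.re_ofReal_mul, hS3ψ, dotProduct_smul, smul_eq_mul,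
    Complex.re_ofReal_mul] at hray1
  set φ := (flipOp : Op (TorusSite 3 L) 2) *ᵥ ψ with hφ
  have hnφ : (star φ ⬝ᵥ φ).re = (star ψ ⬝ᵥ ψ).re := by
    rw [hφ, star_mulVec_dotProduct_mulVec flipOp_conjTranspose_mul]
  have hH₀φ : H₀ *ᵥ φ = (H₀.groundEnergy : ℂ) • φ := by
    have hcomm : flipOp * H₀ = H₀ * flipOp := by
      have := flipOp_mul_hmu L hL 0
      rwa [neg_zero] at this
    rw [hφ, mulVec_mulVec, ← hcomm, ← mulVec_mulVec, hH₀ψ, mulVec_smul]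
  have hS3φ : S3 *ᵥ φ = (-(M : ℂ)) • φ := by
    rw [hφ, mulVec_mulVec, hS3, totalSpin_two_mul_flipOp, Matrix.neg_mulVec, ← hS3,
      ← mulVec_mulVec, hS3ψ, mulVec_smul, neg_smul]
  have hray2 := ray φ
  rw [hHμ_eq, dotProduct_sub, dotProduct_smul, smul_eq_mul, Complex.sub_re, Complex.re_ofReal_mul,
    hH₀φ, dotProduct_smul, smul_eq_mul, Complex.re_ofReal_mul, hS3φ, dotProduct_smul, smul_eq_mul,
    ← Complex.ofReal_neg, Complex.re_ofReal_mul, hnφ] at hray2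
  -- hray1 : Eμ n ≤ E0 n − μ (M n) ; hray2 : Eμ n ≤ E0 n − μ (−M n)
  by_contra hcon
  push Not at hcon
  have h1 : (Hmu L 0).groundEnergy * (star ψ ⬝ᵥ ψ).re < Hμ.groundEnergy * (star ψ ⬝ᵥ ψ).re :=
    mul_lt_mul_of_pos_right hcon nψ
  rcases le_or_gt 0 (μ * M) with hMM | hMM
  · nlinarith [mul_nonneg hMM nψ.le]
  · nlinarith [mul_pos (neg_pos.mpr hMM) nψ]

end OffHalf

end Summit.AtomisticToContinuum.BoseEinsteinCondensation.Cruxes.LatticeODLROOffHalfFilling.Disproof
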